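import Literature.Claims.NS.Permana2026
import Literature.Analysis.FunctionSpaces.SobolevHolderDomain
import Literature.Analysis.FluidPDE.ConstantinFeffermanEnstrophySlab
import Mathlib.Analysis.Calculus.Gradient.Basic
import Literature.Analysis.FluidPDE.VorticityDirectionDynamics
import Literature.Analysis.FluidPDE.VorticityEquation
import Literature.Analysis.FluidPDE.BKMClassVorticityTimeLipschitz
import Mathlib.Analysis.SpecialFunctions.Log.Deriv
import HarnessLib

/-!
# Claim skeleton — ZHONG Huaiming (钟怀明), «Proof of Global Smooth Solutions to the Three-Dimensional
Navier–Stokes Equations via the Floquet Resonance Hypersurface» (Zenodo record 20136199, 2026-05-12, 11 pp.)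

NS-CLAIMS row **C161** (D-0090 sweep; typist ns-claims-typist-9 g5). Text of record: census pin
`census/texts/Zhong2026/` (PDF sha256[:16] `7388635a87288bac`; PDF page = printed page = `pNNN.txt`; `l.N` =
line of the text layer), LOCATORS `sources/Zhong2026/LOCATORS.md` (lit-2 g5 pre-sourced / lit-4 g8 SOURCED).
Bib key `Zhong2026`. The printed statements below are HYPOTHESES of this sweep (nothing is asserted); every
`theorem` is kernel-checked logic / calculus.

CLAIMED STATEMENT — Theorem 6.2 (Global Smoothness) p.8 l.36–37: «For any v₀ ∈ X with s > 5/2, the maximal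
existence time is T_max = ∞. The solution remains globally smooth for all t > 0.» Here X = {v ∈ H^s(ℝ³) :
∇·v = 0}, s > 5/2 ((9) p.4 l.3–7); whole space ℝ³, unforced NSE (1) p.1 l.21–31, every ν > 0.
RENDERING (as in `Chae2007` / `Permana2026`): the data class is the tree's `Chae2007.IsDatum` (smooth, div-free,
all `L²` Sobolev norms finite — the H^∞ corner of the print's X; the print's class is WIDER, so the typed claim
is implied by the printed one and a refutation at this class refutes the print a fortiori —
TODO(general form): H^s data, real s > 5/2); solutions are `Chae2007.IsLocalSolution ν T v₀ u p` (classical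
unforced solution on `ℝ³ × [0,T)` in the Beale–Kato–Majda class) and `Chae2007.IsGlobalSolution`.
`ClaimedTheorem` below is literally `Permana2026.ClaimedTheorem` (`claimed_iff_permana`), so the Clay link
`clay_of_claimed : ClaimedTheorem → clayR3.Regularity` is the tree's (Δ: data axis stronger than (4); (A)-type).

PRINTED CHAIN (proof of Thm 6.2 p.8 l.38–88; LOCATORS §1): local theory + blow-up criterion p.4 l.13–16
(`Chae2007.Step_1`, DISCHARGED in the tree) and BKM [8] p.8 l.38–39 (`Step_BKM`, TRUE-type) reduce the claim to
a uniform sup-vorticity bound on the maximal slab (`VortBound`); §3 objects ψ = ln|ω| (10), f = e^ψ − 2ν|∇ψ|²,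
F = sup f (11), 𝓕 (12); Lemma 3.1 p.4; §4 at the maximum point x₀ of Φ = e^ψ/|∇ψ|² (13): Lemma 4.1 (14) /
Prop 4.2 (15) (first-order condition; TRUE calculus, recorded), Lemma 4.3 (16), identity (17), **the sign step
p.5 l.83–85 «Dψ/Dt(x₀) ≤ 0»** (`Step_sign`), (18) (`step18_of_sign` PROVED), (19) (`Step_subst19` — the
substitution of (16) into (18) AS PRINTED), ‖H⊥‖ bound p.6 l.23–45 (`Step_Hperp`), geometric constraint
«|∇ω̂|² ≤ ⅓|∇ψ|²» p.6 l.53–62 (`Step_geom_le`; printed with «≥» on p.8 l.15–20 = `Step_geom_ge`), (20) with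
53/24 (`step20_of_printed` PROVED, arithmetic), (21) with ½ via «Appendix B» (`Step_AppB`); Lemma 6.1 (27)
p.8 (`Step_27`, `Step_L61_of27`, `Step_L61`); Thm 6.2 Case 1 (`Step_Case1`, via Lemma 3.1) / Case 2
(`Step_Case2`, via Lemma 6.1 and F(t) ≥ ‖ω(·,t)‖_∞ — the latter PROVED: `floc_at_vortMax`, `step_Fge_holds`),
«two mutually exclusive and exhaustive cases» p.8 l.40–41 with the standing hypotheses of §3–§4
(`Step_exhaustive`). §2 (Floquet modulation (5)–(8)) and §5 (Theorems 5.1–5.4) are not on the proof path of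
Thm 6.2 (LOCATORS §3; REF flag (g)) and are not typed.

REF-1 typing-grain flags (11:54:18Z) honoured: (a) «ω ≠ 0 everywhere» / «∇ψ ≠ 0 everywhere» typed verbatim as
hypotheses of the steps that use them (`NonVanishing`, `GradNonVanishing`), the claim kept on the full class;
(b) F and sup Φ only through ATTAINED maxima (`IsFMaxAt`, `IsPhiMaxAt`), never a bare `sSup`; (c) the
material derivative `matDpsi` is an explicit derivative at an explicit point, the Danskin-type passage
«taking the supremum over all trajectories» is its own step (`Step_L61_of27`); (d) 53/24 vs ½ and «≤ ⅓» vs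
«≥ ⅓» typed as printed at each locator; (e) Lemma 3.1 per field, the per-time → uniform inference is
`Step_Case1`; (f) local theory / BKM from the tree (`Chae2007.Step_1`, `Step_BKM`); (g) §5 not typed;
(h) `floc_at_vortMax` is the API lemma «f(x*_t) = ‖ω(·,t)‖_∞ at the vorticity maximum».

COMPOSITION: `claim_of_steps (h1 : Chae2007.Step_1) (hB : Step_BKM) (hV : VortBound) : ClaimedTheorem` and the
print-order `claim_of_printed_steps` (every binder used) PROVED; `clay_of_claimed` PROVED.
* REV 2 (additive; 2-READ typist-1 g5 12:21:52Z): the verbatim «∇ψ ≠ 0 everywhere» makes the §4 faces vacuous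
  on the class; point-grain twins `AtPhiMaxPt`, `Step_sign_pt`, `Step_18_pt`, `Step_19_pt`, `Step_L43_pt`,
  `Step_Hperp_pt`, `Step_20_pt`, `Step_21_pt`, `Step_subst19_pt`, `Step_AppB_pt` (hypothesis only at x₀, as
  the print uses it p.5 l.20–23), `…_of_pt` implications and `claim_of_printed_steps_pt` PROVED — see § REV 2.
* REV 3 (additive; REF-1 REV-2 CAUTION 12:28:09Z): Φ is unbounded near the vorticity maximiser, so the
  attained-sup frame is unsatisfiable too; LOCAL-maximum grain `AtPhiLocMax`, `Step_17_loc`, `Step_sign_loc`,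
  `Step_18_loc`, `Step_L43_loc`, `Step_19_loc`, `Step_subst19_loc`, `Step_Hperp_loc`, `Step_geom_le_loc`,
  `Step_geom_ge_loc`, `Step_20_loc`, `Step_21_loc`, `Step_AppB_loc`, `Step_27_of_loc`, implications
  loc ⇒ pt and `claim_of_printed_steps_loc` PROVED — see § REV 3.
-/

namespace Literature.Claims.NS.Zhong2026

open MeasureTheory Set Filter Topology
open scoped ENNReal NNReal ContDiff RealInnerProductSpace Laplacian
open Literature.Analysis.FluidPDE Literature.Claims.NS.Chae2007

noncomputable section

/-- `ℝ³`. [folklore] -/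
abbrev E3 := EuclideanSpace ℝ (Fin 3)

/-! ## §3 objects (p.4) -/

/-- «For v ∈ X with ω ≠ 0 everywhere» (p.4 l.17) — the standing non-vanishing hypothesis of §3–§4, typed
verbatim on the steps that use it (for a field `w`, here always a vorticity slice). [cite: Zhong2026, §3.1 p.4 l.17] -/
def NonVanishing (w : E3 → E3) : Prop :=
  ∀ x, w x ≠ 0

/-- **(10) p.4 l.17–18**: the logarithmic vorticity «ψ(x) = ln |ω(x)|» of a field `w` (= ω).
[cite: Zhong2026, (10) p.4 l.17–18] -/
def psi (w : E3 → E3) (x : E3) : ℝ :=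
  Real.log ‖w x‖

/-- `∇ψ(x)` (the gradient of (10)). [cite: Zhong2026, (11) p.4 l.28–33] -/
def gpsi (w : E3 → E3) (x : E3) : E3 :=
  gradient (psi w) x

/-- «For v ∈ X with ∇ψ ≠ 0 everywhere» (p.4 l.65–66) — the standing hypothesis of §4, typed verbatim.
[cite: Zhong2026, §4.1 p.4 l.65–66] -/
def GradNonVanishing (w : E3 → E3) : Prop :=
  ∀ x, gpsi w x ≠ 0

/-- **(11) p.4 l.28–33, the local Floquet functional**: «f(x; v) = e^{ψ(x)} − 2ν|∇ψ(x)|²».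
[cite: Zhong2026, (11) p.4 l.28–33] -/
def floc (ν : ℝ) (w : E3 → E3) (x : E3) : ℝ :=
  Real.exp (psi w x) - 2 * ν * ‖gpsi w x‖ ^ 2

/-- **(11), the global Floquet functional «F[v] = sup_{x ∈ ℝ³} f(x; v)»**, typed through ATTAINMENT only
(REF flag (b)): `x₀` attains the supremum defining `F[v]` («the supremum is attainable … a finite maximum point
exists for F > 0», proof of Lemma 3.1 p.4 l.43–44; Lemma 6.1's proof p.8 l.13 «Let x_t be a point at which the
supremum defining F(t) is attained»; Appendix A for the escaping case). [cite: Zhong2026, (11) p.4 l.28–33; p.4 l.43–44; p.8 l.13] -/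
def IsFMaxAt (ν : ℝ) (w : E3 → E3) (x₀ : E3) : Prop :=
  ∀ x, floc ν w x ≤ floc ν w x₀

/-- **(13) p.4 l.65–70, the auxiliary functional «Φ(x) = e^{ψ(x)} / |∇ψ(x)|²»**.
[cite: Zhong2026, (13) p.4 l.65–70] -/
def Phi (w : E3 → E3) (x : E3) : ℝ :=
  Real.exp (psi w x) / ‖gpsi w x‖ ^ 2

/-- «M = sup_x Φ(x) … attained at an interior point x₀» (p.4 l.71–75), typed through attainment (REF flag (b)).
[cite: Zhong2026, §4.1 p.4 l.71–75] -/
def IsPhiMaxAt (w : E3 → E3) (x₀ : E3) : Prop :=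
  ∀ x, Phi w x ≤ Phi w x₀

/-- The Hessian `∇²ψ(x)` as a linear map (derivative of the gradient field). [cite: Zhong2026, (14)–(16) p.5] -/
def hessPsi (w : E3 → E3) (x : E3) : E3 →L[ℝ] E3 :=
  fderiv ℝ (gpsi w) x

/-- The unit direction field «ω̂ = ω/|ω|» (p.3 l.14; (17) p.5). [cite: Zhong2026, (4) p.3 l.14–17] -/
def dirField (w : E3 → E3) (x : E3) : E3 :=
  ‖w x‖⁻¹ • w x

/-- «|∇ω̂|²» (the Frobenius square of the derivative of the direction field; (17) p.5 l.82, p.6 l.53–62).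
[cite: Zhong2026, (17) p.5 l.72–82; p.6 l.53–62] -/
def gradDirSq (w : E3 → E3) (x : E3) : ℝ :=
  frobeniusNormSq (fderiv ℝ (dirField w) x)

/-- «∆e^ψ / e^ψ» = `Δ|ω| / |ω|` ((16)–(18) p.5). [cite: Zhong2026, (16)–(18) p.5 l.60–92] -/
def lapRatio (w : E3 → E3) (x : E3) : ℝ :=
  (Δ (fun y => ‖w y‖)) x / ‖w x‖

/-- **(4) p.3 l.14–17, the vortex-stretching rate «S₀ = ω̂ · ∇v · ω̂»** of a velocity field `v` at `x`
(`ω = curl v`). [cite: Zhong2026, (4) p.3 l.14–17] -/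
def S0 (v : E3 → E3) (x : E3) : ℝ :=
  ⟪curl v x, (fderiv ℝ v x) (curl v x)⟫ / ‖curl v x‖ ^ 2

/-- The material derivative «Dψ/Dt» of ψ = ln|ω| along a velocity `u` at `(t, x)`: `∂ₜψ + u·∇ψ`, an explicit
derivative at an explicit point (REF flag (c)). [cite: Zhong2026, (17) p.5 l.72–82] -/
def matDpsi (u : ℝ → E3 → E3) (t : ℝ) (x : E3) : ℝ :=
  deriv (fun s => psi (curl (u s)) x) t + ⟪u t x, gpsi (curl (u t)) x⟫

/-- The material derivative «Df/Dt» of the local functional (11) along `u` at `(t, x)` ((27) p.8).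
[cite: Zhong2026, (27) p.8 l.13–30] -/
def matDf (ν : ℝ) (u : ℝ → E3 → E3) (t : ℝ) (x : E3) : ℝ :=
  deriv (fun s => floc ν (curl (u s)) x) t + ⟪u t x, gradient (floc ν (curl (u t))) x⟫

/-! ## The claimed statement (Theorem 6.2 p.8) and its Clay link -/

/-- **CLAIMED STATEMENT — Theorem 6.2 (Global Smoothness) p.8 l.36–37**: «For any v₀ ∈ X with s > 5/2, the
maximal existence time is T_max = ∞. The solution remains globally smooth for all t > 0.» Rendered at the
tree's class (module docstring): for every `ν > 0` and every datum of `Chae2007.IsDatum` there is a global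
classical solution in the BKM class. [claim: Zhong2026, status: under-review]
[cite: Zhong2026, Theorem 6.2 p.8 l.36–37; X = (9) p.4 l.3–7; abstract p.1 l.5–19] -/
def ClaimedTheorem : Prop :=
  ∀ ν : ℝ, 0 < ν → ∀ v₀ : E3 → E3, IsDatum v₀ →
    ∃ (u : ℝ → E3 → E3) (p : ℝ → E3 → ℝ), IsGlobalSolution ν v₀ u p

/-- The typed claim is literally the statement typed for `Permana2026` (same class, same conclusion).
[cite: Zhong2026, Theorem 6.2 p.8] -/
theorem claimed_iff_permana : ClaimedTheorem ↔ Permana2026.ClaimedTheorem := Iff.rfl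

/-- **Clay link**: the claimed statement implies Clay (A) `ClayVariants.clayR3.Regularity` (Schwartz-class data
are in the class; bounded energy from the Sobolev bounds) — the tree's `Permana2026.clay_of_claimed`.
[cite: Zhong2026, Theorem 6.2 p.8; §1.1 p.1 l.28–31 (Clay [4] named)] -/
theorem clay_of_claimed (h : ClaimedTheorem) : ClayVariants.clayR3.Regularity :=
  Permana2026.clay_of_claimed h

/-! ## The reduction to a sup-vorticity bound (p.4 l.13–16, p.8 l.38–39, l.85–87) -/

/-- The contradiction target of the proof of Thm 6.2 (p.8 l.38–39 «this implies ‖ω(·,t)‖_{L∞} → ∞ as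
t → T_max», l.82–87): along every classical solution of the class on a slab `[0,T)`, `T > 0`, the vorticity is
uniformly bounded. [claim: Zhong2026, status: under-review] [cite: Zhong2026, proof of Theorem 6.2 p.8 l.38–39, l.82–87] -/
def VortBound : Prop :=
  ∀ ν : ℝ, 0 < ν → ∀ T : ℝ, 0 < T → ∀ (v₀ : E3 → E3) (u : ℝ → E3 → E3) (p : ℝ → E3 → ℝ),
    IsLocalSolution ν T v₀ u p → ∃ B : ℝ, ∀ t ∈ Ico 0 T, ∀ x, ‖curl (u t) x‖ ≤ B

/-- **BKM as used, p.8 l.38–39** «By the BKM blow-up criterion [8], [T_max < ∞] implies ‖ω(·,t)‖_{L∞} → ∞ as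
t → T_max» (contrapositive, in the class): a uniform sup-vorticity bound on `[0,T)` excludes `H³` blow-up at
`T`. TRUE-type (Beale–Kato–Majda 1984; in substance the tree's DISCHARGED `Chae2007.Step_2` =
`MajdaBertozzi2002_bkmAprioriH3`, up to the bookkeeping `sup ⇒ ∫₀ᵀ‖ω‖_∞ < ∞`). [claim: Zhong2026, status: under-review]
[cite: Zhong2026, proof of Theorem 6.2 p.8 l.38–39 (citing [8] Beale–Kato–Majda 1984); §3.1 p.4 l.13–16] -/
def Step_BKM : Prop :=
  ∀ ν : ℝ, 0 < ν → ∀ T : ℝ, 0 < T → ∀ (v₀ : E3 → E3) (u : ℝ → E3 → E3) (p : ℝ → E3 → ℝ),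
    IsLocalSolution ν T v₀ u p → (∃ B : ℝ, ∀ t ∈ Ico 0 T, ∀ x, ‖curl (u t) x‖ ≤ B) → ¬ BlowsUpAt T u

/-- **Composition of the reduction (p.4 l.13–16 + p.8 l.38–39, l.85–87)**: the local theory with blow-up
alternative (`Chae2007.Step_1`, DISCHARGED in the tree as `Chae2007.step_1_holds`), BKM, and the uniform
vorticity bound give Theorem 6.2. [cite: Zhong2026, proof of Theorem 6.2 p.8 l.38–39, l.85–87] -/
theorem claim_of_steps (h1 : Chae2007.Step_1) (hB : Step_BKM) (hV : VortBound) : ClaimedTheorem := by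
  intro ν hν v₀ hv₀
  rcases h1 ν hν.le v₀ hv₀ with hglob | ⟨T, hT, u, p, hsol, hblow⟩
  · exact hglob
  · exact absurd hblow (hB ν hν T hT v₀ u p hsol (hV ν hν T hT v₀ u p hsol))

/-! ## Lemma 3.1 (p.4) and the §4 chain (pp.4–6) — step hypotheses in print order -/

/-- **Lemma 3.1 (Absence of Singularities on 𝓕) p.4 l.42–55**: «Let v ∈ 𝓕. Then ‖ω‖_{L∞} < ∞» — per FIELD
(REF flag (e)): a class field (smooth, div-free, all Sobolev norms finite) with ω ≠ 0 everywhere whose F-value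
is attained and equals 0 has bounded vorticity. TRUE-type at this class (H^∞ fields have bounded curl).
[claim: Zhong2026, status: under-review] [cite: Zhong2026, Lemma 3.1 p.4 l.42–55; 𝓕 = (12) p.4 l.34–38] -/
def Step_L31 : Prop :=
  ∀ ν : ℝ, 0 < ν → ∀ v : E3 → E3, IsDatum v → NonVanishing (curl v) →
    ∀ x₀, IsFMaxAt ν (curl v) x₀ → floc ν (curl v) x₀ = 0 → ∃ B : ℝ, ∀ x, ‖curl v x‖ ≤ B

/-- **Lemma 4.1 (14) p.5 l.2–23 with Prop 4.2 (15) p.5 l.25–55 (first-order condition at the maximum point x₀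
of Φ)**: «∇²ψ(∇ψ) = ½|∇ψ|²(∇ψ)» — ∇ψ(x₀) is an eigenvector of the Hessian with eigenvalue ½|∇ψ|² (whence the
block form (15)). TRUE-type calculus (Fermat + quotient rule), recorded; not consumed below.
[claim: Zhong2026, status: under-review] [cite: Zhong2026, Lemma 4.1 (14) p.5 l.2–23; Proposition 4.2 (15) p.5 l.25–55] -/
def Step_L41 : Prop :=
  ∀ v : E3 → E3, IsDatum v → NonVanishing (curl v) → GradNonVanishing (curl v) →
    ∀ x₀, IsPhiMaxAt (curl v) x₀ →
      hessPsi (curl v) x₀ (gpsi (curl v) x₀) = (1 / 2 * ‖gpsi (curl v) x₀‖ ^ 2) • gpsi (curl v) x₀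

/-- **Lemma 4.3 (16) p.5 l.60–71 (second-order condition)**: «∇²Φ(x₀) ≤ 0. Taking the trace … yields
∆e^ψ/e^ψ ≤ 2|∇²ψ|²/|∇ψ|²» at the maximum point x₀ of Φ (|∇²ψ|² = Frobenius square of the Hessian).
[claim: Zhong2026, status: under-review] [cite: Zhong2026, Lemma 4.3 (16) p.5 l.60–71] -/
def Step_L43 : Prop :=
  ∀ v : E3 → E3, IsDatum v → NonVanishing (curl v) → GradNonVanishing (curl v) →
    ∀ x₀, IsPhiMaxAt (curl v) x₀ →
      lapRatio (curl v) x₀ ≤ 2 * frobeniusNormSq (hessPsi (curl v) x₀) / ‖gpsi (curl v) x₀‖ ^ 2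

/-- The common frame of the dynamical §4 faces: a class solution on `[0,T)`, an interior time `t`, the
standing hypotheses «ω ≠ 0 everywhere», «∇ψ ≠ 0 everywhere» at time `t`, and a point `x₀` attaining `sup Φ`
with «F[v] > 0 ⟺ sup_x Φ(x) > 2ν» (p.4 l.71). [cite: Zhong2026, §4.1 p.4 l.65–75] -/
def AtPhiMax (ν T : ℝ) (v₀ : E3 → E3) (u : ℝ → E3 → E3) (p : ℝ → E3 → ℝ) (t : ℝ) (x₀ : E3) : Prop :=
  IsLocalSolution ν T v₀ u p ∧ t ∈ Ioo 0 T ∧ NonVanishing (curl (u t)) ∧ GradNonVanishing (curl (u t)) ∧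
    IsPhiMaxAt (curl (u t)) x₀ ∧ 2 * ν < Phi (curl (u t)) x₀

/-- **(17) p.5 l.72–82**: «From the vorticity equation (2), the material derivative of the logarithmic vorticity
ψ is Dψ/Dt = S₀ + ν∆e^ψ/e^ψ − ν|∇ψ|² − ν|∇ω̂|²» — along class solutions at interior times where ω ≠ 0
everywhere. RECORDS (CHAIR lead-1 g6 14:07Z (3); 2-READ ADDENDUM typist-1 g5 13:57:19Z; REF-1 g6 14:03:38Z; RETYPE v0.7): NOT an
identity as printed — the «−ν|∇ψ|²» term is spurious (`Δe^ψ/e^ψ = Δψ + |∇ψ|²`); the |ω|-transport identity reads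
`Dψ/Dt = S₀ + νΔe^ψ/e^ψ − ν|∇ω̂|²`, kernel-checked Summits-side as `…Theorems.Zhong2026Salvage.matDpsi_eq` (p537261) with
`printed17_iff_gpsi_eq_zero` / `step_17_iff_frame_empty`, and IN-FILE (section `Rev8` below, rev 8 p545897) as
`matDpsi_eq` / `printed17_iff_gpsi_eq_zero` / `step_17_iff_frame_empty` / `step_17_loc_iff_irrotational` (the pointwise
grain `Step_17_loc` forces `curl (u t) = 0`); this decl is kept VERBATIM (V-or-FL record; head #144
`Step_exhaustive` unaffected). [claim: Zhong2026, status: under-review] [cite: Zhong2026, (17) p.5 l.72–82] -/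
def Step_17 : Prop :=
  ∀ ν : ℝ, 0 < ν → ∀ (T : ℝ) (v₀ : E3 → E3) (u : ℝ → E3 → E3) (p : ℝ → E3 → ℝ), IsLocalSolution ν T v₀ u p →
    ∀ t ∈ Ioo 0 T, NonVanishing (curl (u t)) → ∀ x,
      matDpsi u t x = S0 (u t) x + ν * lapRatio (curl (u t)) x - ν * ‖gpsi (curl (u t)) x‖ ^ 2 -
        ν * gradDirSq (curl (u t)) x

/-- **THE SIGN STEP, p.5 l.83–85**: «At the global maximum point x₀, the material derivative must be
non-positive—otherwise the value of Φ would increase further along the trajectory, contradicting maximality.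
Hence Dψ/Dt(x₀) ≤ 0» — for every class solution, every interior time, at every point attaining sup Φ(·,t) in
the region F > 0 (frame `AtPhiMax`). Typist's flag (no verdict): x₀ is a SPATIAL maximum of Φ(·,t) at fixed
t; the sentence infers the sign of a material TIME derivative of ψ (LOCATORS §3: the first inequality of §4 that
is not an identity / second-order condition); under v ↦ A·v at t = 0, S₀ scales like A while the ν-terms of
(17) are scale-free. [claim: Zhong2026, status: under-review] [cite: Zhong2026, §4.3 p.5 l.83–85] -/
def Step_sign : Prop :=
  ∀ (ν T : ℝ) (v₀ : E3 → E3) (u : ℝ → E3 → E3) (p : ℝ → E3 → ℝ) (t : ℝ) (x₀ : E3), 0 < ν →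
    AtPhiMax ν T v₀ u p t x₀ → matDpsi u t x₀ ≤ 0

/-- **(18) p.5 l.85–92**: «which yields S₀(x₀) ≤ −ν∆e^ψ/e^ψ + ν|∇ψ|² + ν|∇ω̂|²» (frame `AtPhiMax`).
[claim: Zhong2026, status: under-review] [cite: Zhong2026, (18) p.5 l.85–92] -/
def Step_18 : Prop :=
  ∀ (ν T : ℝ) (v₀ : E3 → E3) (u : ℝ → E3 → E3) (p : ℝ → E3 → ℝ) (t : ℝ) (x₀ : E3), 0 < ν →
    AtPhiMax ν T v₀ u p t x₀ →
      S0 (u t) x₀ ≤ -ν * lapRatio (curl (u t)) x₀ + ν * ‖gpsi (curl (u t)) x₀‖ ^ 2 + ν * gradDirSq (curl (u t)) x₀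

/-- (18) from the sign step and the identity (17) (linear arithmetic). [cite: Zhong2026, (17)–(18) p.5 l.72–92] -/
theorem step18_of_sign (hs : Step_sign) (h17 : Step_17) : Step_18 := by
  intro ν T v₀ u p t x₀ hν hA
  have hle := hs ν T v₀ u p t x₀ hν hA
  rw [h17 ν hν T v₀ u p hA.1 t hA.2.1 hA.2.2.1 x₀] at hle
  linarith

/-- **(19) p.6 l.2–9**: «Substituting the second-order condition (16): S₀(x₀) ≤ 2ν|∇²ψ|²/|∇ψ|² + ν|∇ψ|² +
ν|∇ω̂|²» (frame `AtPhiMax`). [claim: Zhong2026, status: under-review] [cite: Zhong2026, (19) p.6 l.2–9] -/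
def Step_19 : Prop :=
  ∀ (ν T : ℝ) (v₀ : E3 → E3) (u : ℝ → E3 → E3) (p : ℝ → E3 → ℝ) (t : ℝ) (x₀ : E3), 0 < ν →
    AtPhiMax ν T v₀ u p t x₀ →
      S0 (u t) x₀ ≤ 2 * ν * frobeniusNormSq (hessPsi (curl (u t)) x₀) / ‖gpsi (curl (u t)) x₀‖ ^ 2 +
        ν * ‖gpsi (curl (u t)) x₀‖ ^ 2 + ν * gradDirSq (curl (u t)) x₀

/-- **The substitution p.6 l.2 AS PRINTED**: (18) and (16) give (19). Typed as the inference (REF flag (d):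
directions as printed — (16) bounds ∆e^ψ/e^ψ from ABOVE while (18) carries the term −ν∆e^ψ/e^ψ).
[claim: Zhong2026, status: under-review] [cite: Zhong2026, p.6 l.2–9 («Substituting the second-order condition (16)»)] -/
def Step_subst19 : Prop :=
  Step_18 → Step_L43 → Step_19

/-- **p.6 l.23–45**: «An exact computation (see Appendix B for the complete expansion) yields ‖H⊥‖²_F ≤
(3/16)|∇ψ|⁴. Consequently, |∇²ψ|² ≤ (1/4 + 3/16)|∇ψ|⁴ = (7/16)|∇ψ|⁴» at the maximum point of Φ — typed as the
consequence display for the full Hessian (per field; LOCATORS §3: Appendix B as printed does not contain the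
expansion). [claim: Zhong2026, status: under-review] [cite: Zhong2026, §4.3 p.6 l.23–45] -/
def Step_Hperp : Prop :=
  ∀ v : E3 → E3, IsDatum v → NonVanishing (curl v) → GradNonVanishing (curl v) →
    ∀ x₀, IsPhiMaxAt (curl v) x₀ →
      frobeniusNormSq (hessPsi (curl v) x₀) ≤ 7 / 16 * ‖gpsi (curl v) x₀‖ ^ 4

/-- **The geometric constraint, p.6 l.53–62, as printed there («≤»)**: «the geometric constraint of vortex
filaments provides |∇ω̂|² ≤ ⅓|∇ψ|² (the bending rate of a vortex line is controlled by the gradient of the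
vorticity magnitude, with the constant 1/3 being the optimal geometric bound in three dimensions)» — stated
without restriction to x₀; typed pointwise for every class field with ω ≠ 0 everywhere.
[claim: Zhong2026, status: under-review] [cite: Zhong2026, §4.3 p.6 l.53–62] -/
def Step_geom_le : Prop :=
  ∀ v : E3 → E3, IsDatum v → NonVanishing (curl v) → ∀ x, gradDirSq (curl v) x ≤ 1 / 3 * ‖gpsi (curl v) x‖ ^ 2

/-- **(20) p.6 l.63–77**: «Assembling all contributions: S₀(x₀) ≤ (7/8 + 1 + 1/3)ν|∇ψ|² = (53/24)ν|∇ψ|²»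
(frame `AtPhiMax`). [claim: Zhong2026, status: under-review] [cite: Zhong2026, (20) p.6 l.63–77] -/
def Step_20 : Prop :=
  ∀ (ν T : ℝ) (v₀ : E3 → E3) (u : ℝ → E3 → E3) (p : ℝ → E3 → ℝ) (t : ℝ) (x₀ : E3), 0 < ν →
    AtPhiMax ν T v₀ u p t x₀ → S0 (u t) x₀ ≤ 53 / 24 * ν * ‖gpsi (curl (u t)) x₀‖ ^ 2

/-- The class slices of a class solution are class fields (smooth, div-free, all Sobolev norms finite).
[folklore] -/
private theorem isDatum_slice {ν T : ℝ} {v₀ : E3 → E3} {u : ℝ → E3 → E3} {p : ℝ → E3 → ℝ}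
    (h : IsLocalSolution ν T v₀ u p) {t : ℝ} (ht : t ∈ Ioo 0 T) : IsDatum (u t) := by
  have htI : t ∈ Ico 0 T := ⟨ht.1.le, ht.2⟩
  refine ⟨h.isClassical.contDiff_velocity htI, fun x => h.isClassical.divFree t htI x, fun n => ?_⟩
  obtain ⟨T'', hT''⟩ : ∃ T'' : ℝ, t ≤ T'' ∧ T'' < T := ⟨t, le_rfl, ht.2⟩
  obtain ⟨C, hC⟩ := h.sobolev T'' hT''.2 n
  exact (hC t ⟨ht.1.le, hT''.1⟩).trans_lt ENNReal.coe_lt_top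

/-- **(20) from (19), the Hessian bound and the geometric constraint («≤» version)** — the printed assembly
«2|∇²ψ|²/|∇ψ|² ≤ (7/8)|∇ψ|²», «+ ν|∇ψ|²», «+ ⅓ν|∇ψ|²» is real arithmetic (uses ∇ψ(x₀) ≠ 0).
[cite: Zhong2026, (19)–(20) p.6 l.2–77] -/
theorem step20_of_printed (h19 : Step_19) (hH : Step_Hperp) (hg : Step_geom_le) : Step_20 := by
  intro ν T v₀ u p t x₀ hν hA
  obtain ⟨hsol, ht, hnv, hgnv, hmax, _hF⟩ := hA
  have hdat : IsDatum (u t) := isDatum_slice hsol ht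
  have h1 := h19 ν T v₀ u p t x₀ hν ⟨hsol, ht, hnv, hgnv, hmax, _hF⟩
  have h2 := hH (u t) hdat hnv hgnv x₀ hmax
  have h3 := hg (u t) hdat hnv x₀
  set g : ℝ := ‖gpsi (curl (u t)) x₀‖ with hg_def
  have hgpos : 0 < g := norm_pos_iff.mpr (hgnv x₀)
  have hg2 : 0 < g ^ 2 := by positivity
  have hfrac : 2 * ν * frobeniusNormSq (hessPsi (curl (u t)) x₀) / g ^ 2 ≤ 7 / 8 * ν * g ^ 2 := by
    rw [div_le_iff₀ hg2]
    have : 2 * ν * frobeniusNormSq (hessPsi (curl (u t)) x₀) ≤ 2 * ν * (7 / 16 * g ^ 4) :=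
      mul_le_mul_of_nonneg_left h2 (by positivity)
    nlinarith [this]
  have hgeom : ν * gradDirSq (curl (u t)) x₀ ≤ ν * (1 / 3 * g ^ 2) := mul_le_mul_of_nonneg_left h3 hν.le
  linarith [h1, hfrac, hgeom]

/-- **(21) p.6 l.78–87, the sharp bound**: «The detailed computation, carried out in Appendix B, establishes:
S₀(x₀) ≤ ½ν|∇ψ(x₀)|²» (frame `AtPhiMax`; = the abstract's «bounding the vortex stretching rate by half the
characteristic frequency of viscous dissipation», and §4's goal p.4 l.58–64 «S₀ ≤ ½ν|∇ψ|² at every point where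
F[v] > 0»). [claim: Zhong2026, status: under-review] [cite: Zhong2026, (21) p.6 l.78–87; §4 p.4 l.58–64; abstract p.1 l.5–19] -/
def Step_21 : Prop :=
  ∀ (ν T : ℝ) (v₀ : E3 → E3) (u : ℝ → E3 → E3) (p : ℝ → E3 → ℝ) (t : ℝ) (x₀ : E3), 0 < ν →
    AtPhiMax ν T v₀ u p t x₀ → S0 (u t) x₀ ≤ 1 / 2 * ν * ‖gpsi (curl (u t)) x₀‖ ^ 2

/-- **«Appendix B» step, p.6 l.78–87**: «The coefficient 53/24 ≈ 2.208 is not yet the sharp 1/2. The tightening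
… The detailed computation, carried out in Appendix B, establishes (21)» — typed as the inference (20) ⇒ (21)
(REF flag (d); LOCATORS §3: Appendix B p.10 l.30–70 derives «≤ ⅓ν|∇ψ|²» by another route and states the
½-version in prose). [claim: Zhong2026, status: under-review] [cite: Zhong2026, p.6 l.78–87; Appendix B p.10 l.30–70] -/
def Step_AppB : Prop :=
  Step_20 → Step_21

/-! ## Lemma 6.1 (p.8 l.10–35) -/

/-- **The geometric constraint as printed in the proof of Lemma 6.1, p.8 l.15–21 («≥»)**: «together with the
geometric constraint |∇ω̂|² ≥ ⅓|∇ψ|²» — pointwise for class fields with ω ≠ 0 everywhere (REF flag (d): the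
p.6 l.54 version reads «≤», `Step_geom_le`). [claim: Zhong2026, status: under-review] [cite: Zhong2026, proof of Lemma 6.1 p.8 l.15–21] -/
def Step_geom_ge : Prop :=
  ∀ v : E3 → E3, IsDatum v → NonVanishing (curl v) → ∀ x, 1 / 3 * ‖gpsi (curl v) x‖ ^ 2 ≤ gradDirSq (curl v) x

/-- **(27) p.8 l.13–30**: «Let x_t be a point at which the supremum defining F(t) = F[S(t)v₀] is attained.
Computing the material derivative of f … yields after algebraic simplification: Df/Dt ≤ −(ν/6)|∇ψ|² f» — at
every interior time, at every point attaining F(t), along class solutions with ω ≠ 0 everywhere and F(t) > 0.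
[claim: Zhong2026, status: under-review] [cite: Zhong2026, (27) p.8 l.13–30] -/
def Step_27 : Prop :=
  ∀ ν : ℝ, 0 < ν → ∀ (T : ℝ) (v₀ : E3 → E3) (u : ℝ → E3 → E3) (p : ℝ → E3 → ℝ), IsLocalSolution ν T v₀ u p →
    ∀ t ∈ Ioo 0 T, NonVanishing (curl (u t)) → ∀ x₁, IsFMaxAt ν (curl (u t)) x₁ → 0 < floc ν (curl (u t)) x₁ →
      matDf ν u t x₁ ≤ -(ν / 6) * ‖gpsi (curl (u t)) x₁‖ ^ 2 * floc ν (curl (u t)) x₁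

/-- **The derivation of (27), p.8 l.13–22, as an inference**: «substituting the sharp bound (21), together with
the geometric constraint |∇ω̂|² ≥ ⅓|∇ψ|², yields after algebraic simplification (27)» ((21) is typed at the
maximum point of Φ, (27) at the maximum point of f; the algebra is not displayed).
[claim: Zhong2026, status: under-review] [cite: Zhong2026, proof of Lemma 6.1 p.8 l.13–22] -/
def Step_27_of : Prop :=
  Step_21 → Step_geom_ge → Step_27

/-- **Lemma 6.1 (Monotonic Convergence of Outer Trajectories) p.8 l.10–12, the monotonicity clause**: «For any
initial data v₀ ∈ X \ 𝓕 with F[v₀] > 0, the functional F[S(t)v₀] is strictly monotonically decreasing along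
the Navier–Stokes trajectory» — typed through attained values (REF flags (b)(c)): along a class solution on
`[0,T)` with ω ≠ 0 everywhere at all times, for `t₁ < t₂` in `[0,T)` with F(t₁) > 0 attained at x₁ and F(t₂)
attained at x₂, `f(t₂; x₂) < f(t₁; x₁)`. (The clause «lim_{t→∞} F = 0» is not used by the proof of Thm 6.2 and
is not typed.) [claim: Zhong2026, status: under-review] [cite: Zhong2026, Lemma 6.1 p.8 l.10–12, proof l.13–35] -/
def Step_L61 : Prop :=
  ∀ ν : ℝ, 0 < ν → ∀ (T : ℝ) (v₀ : E3 → E3) (u : ℝ → E3 → E3) (p : ℝ → E3 → ℝ), IsLocalSolution ν T v₀ u p →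
    (∀ t ∈ Ico 0 T, NonVanishing (curl (u t))) →
      ∀ t₁ ∈ Ico 0 T, ∀ t₂ ∈ Ico 0 T, t₁ < t₂ →
        ∀ x₁, IsFMaxAt ν (curl (u t₁)) x₁ → 0 < floc ν (curl (u t₁)) x₁ →
          ∀ x₂, IsFMaxAt ν (curl (u t₂)) x₂ → floc ν (curl (u t₂)) x₂ < floc ν (curl (u t₁)) x₁

/-- **From (27) to Lemma 6.1, p.8 l.31–35**: «this differential inequality guarantees exponential decay of f
along the trajectory. Taking the supremum over all trajectories, F(t) inherits the strict monotonic decay» —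
the Danskin-type passage from a pointwise material-derivative inequality at the moving maximiser to monotonicity
of the supremum, typed as its own inference (REF flag (c)). [claim: Zhong2026, status: under-review]
[cite: Zhong2026, proof of Lemma 6.1 p.8 l.31–35] -/
def Step_L61_of27 : Prop :=
  Step_27 → Step_L61

/-! ## Theorem 6.2, the two cases (p.8 l.40–84) -/

/-- **API lemma (REF flag (h)) — p.8 l.47–75**: at a point `x*` where `‖w‖` attains its global maximum, with
`w x* ≠ 0` and `w` differentiable there, «the gradient must vanish: ∇|ω|(x*) = 0, which implies ∇ψ(x*) = 0»
and «f(x*) = |ω(x*)| − 2ν|∇ψ(x*)|² = ‖ω‖_{L∞}». PROVED (Fermat). [cite: Zhong2026, proof of Theorem 6.2 p.8 l.47–75] -/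
theorem floc_at_vortMax (ν : ℝ) {w : E3 → E3} {xs : E3} (hd : DifferentiableAt ℝ w xs) (hne : w xs ≠ 0)
    (hmax : ∀ x, ‖w x‖ ≤ ‖w xs‖) : gpsi w xs = 0 ∧ floc ν w xs = ‖w xs‖ := by
  have hpos : 0 < ‖w xs‖ := norm_pos_iff.mpr hne
  have hdn : DifferentiableAt ℝ (fun x => ‖w x‖) xs := hd.norm ℝ hne
  have hlocal : IsLocalMax (fun x => ‖w x‖) xs := Filter.Eventually.of_forall fun x => hmax x
  have hfdn : fderiv ℝ (fun x => ‖w x‖) xs = 0 := hlocal.fderiv_eq_zero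
  have hpsi : psi w = Real.log ∘ fun x => ‖w x‖ := rfl
  have hfd : fderiv ℝ (psi w) xs = 0 := by
    rw [hpsi, fderiv_comp xs (Real.differentiableAt_log hpos.ne') hdn, hfdn, ContinuousLinearMap.comp_zero]
  have hg : gpsi w xs = 0 := by
    unfold gpsi gradient
    rw [hfd, map_zero]
  refine ⟨hg, ?_⟩
  unfold floc
  rw [hg, norm_zero]
  unfold psi
  rw [Real.exp_log hpos]
  ring

/-- **p.8 l.76–81 «F(t) = sup_x f(x; v) ≥ f(x*_t) … F(t) ≥ ‖ω(·,t)‖_{L∞}»**, typed through attainment: for a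
differentiable field `w` with an attained vorticity maximum `x*`, `w x* ≠ 0`, and a point `x_F` attaining F,
`‖w x*‖ ≤ f(x_F; ·)`. [claim: Zhong2026, status: under-review] [cite: Zhong2026, proof of Theorem 6.2 p.8 l.47–81] -/
def Step_Fge : Prop :=
  ∀ (ν : ℝ) (w : E3 → E3) (xs xF : E3), Differentiable ℝ w → w xs ≠ 0 → (∀ x, ‖w x‖ ≤ ‖w xs‖) →
    IsFMaxAt ν w xF → ‖w xs‖ ≤ floc ν w xF

/-- `Step_Fge` holds (from `floc_at_vortMax`). [cite: Zhong2026, proof of Theorem 6.2 p.8 l.47–81] -/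
theorem step_Fge_holds : Step_Fge := by
  intro ν w xs xF hd hne hmax hF
  rw [← (floc_at_vortMax ν (hd xs) hne hmax).2]
  exact hF xs

/-- **«Two mutually exclusive and exhaustive cases arise» (p.8 l.40–41) with the standing hypotheses under
which Cases 1–2 are argued**: along every class solution on `[0,T)`, at every time, «ω ≠ 0 everywhere» (p.4
l.17, needed for ψ, f, F), the supremum defining F(t) is attained (p.8 l.13; p.4 l.43–44), and «the spatial
point x*_t where the vorticity magnitude attains its global maximum» exists (p.8 l.47–53). Typed verbatim as
the assertion that the case analysis applies to every trajectory of the class (REF flag (a): the claimed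
statement stays on the full class, the mismatch is visible here). Typist's note: this face records standing
hypotheses, not one of the print's derivations. [claim: Zhong2026, status: under-review]
[cite: Zhong2026, proof of Theorem 6.2 p.8 l.40–41, l.47–53; §3.1 p.4 l.17, l.43–44; p.8 l.13] -/
def Step_exhaustive : Prop :=
  ∀ ν : ℝ, 0 < ν → ∀ T : ℝ, 0 < T → ∀ (v₀ : E3 → E3) (u : ℝ → E3 → E3) (p : ℝ → E3 → ℝ),
    IsLocalSolution ν T v₀ u p →
      (∀ t ∈ Ico 0 T, NonVanishing (curl (u t))) ∧
      (∀ t ∈ Ico 0 T, ∃ xF, IsFMaxAt ν (curl (u t)) xF) ∧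
      (∀ t ∈ Ico 0 T, ∃ xs, ∀ x, ‖curl (u t) x‖ ≤ ‖curl (u t) xs‖)

/-- **Case 1, p.8 l.42–44**: «There exists t₁ < T_max such that F(t₁) ≤ 0. The trajectory has crossed or been
captured by 𝓕. By Lemma 3.1, vorticity on and within 𝓕 is strictly bounded, directly contradicting the
blow-up hypothesis ‖ω‖_{L∞} → ∞» — typed as the inference from Lemma 3.1 (a per-field statement at F = 0) to a
UNIFORM sup-vorticity bound on `[0,T)` for every class trajectory with some F(t₁) ≤ 0 (REF flag (e)).
[claim: Zhong2026, status: under-review] [cite: Zhong2026, proof of Theorem 6.2, Case 1 p.8 l.42–44] -/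
def Step_Case1 : Prop :=
  Step_L31 →
    ∀ ν : ℝ, 0 < ν → ∀ T : ℝ, 0 < T → ∀ (v₀ : E3 → E3) (u : ℝ → E3 → E3) (p : ℝ → E3 → ℝ),
      IsLocalSolution ν T v₀ u p → (∀ t ∈ Ico 0 T, NonVanishing (curl (u t))) →
        (∃ t₁ ∈ Ico 0 T, ∃ x₁, IsFMaxAt ν (curl (u t₁)) x₁ ∧ floc ν (curl (u t₁)) x₁ ≤ 0) →
          ∃ B : ℝ, ∀ t ∈ Ico 0 T, ∀ x, ‖curl (u t) x‖ ≤ B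

/-- **Case 2, p.8 l.45–84**: «For all t < T_max, F(t) > 0. By Lemma 6.1, F(t) must monotonically decrease and
remain bounded by F(0). … F(t) ≥ ‖ω(·,t)‖_{L∞} … contradicts the monotonic decay and absolute boundedness of
F(t)» — typed as the inference from Lemma 6.1 and `Step_Fge` to a uniform sup-vorticity bound on `[0,T)` for
every class trajectory with F(t) > 0 attained and the vorticity maximum attained at all times. PROVED below
(`step_Case2_holds`: the bound is F(0)). [claim: Zhong2026, status: under-review]
[cite: Zhong2026, proof of Theorem 6.2, Case 2 p.8 l.45–84] -/
def Step_Case2 : Prop :=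
  Step_L61 → Step_Fge →
    ∀ ν : ℝ, 0 < ν → ∀ T : ℝ, 0 < T → ∀ (v₀ : E3 → E3) (u : ℝ → E3 → E3) (p : ℝ → E3 → ℝ),
      IsLocalSolution ν T v₀ u p → (∀ t ∈ Ico 0 T, NonVanishing (curl (u t))) →
        (∀ t ∈ Ico 0 T, ∃ xF, IsFMaxAt ν (curl (u t)) xF ∧ 0 < floc ν (curl (u t)) xF) →
          (∀ t ∈ Ico 0 T, ∃ xs, ∀ x, ‖curl (u t) x‖ ≤ ‖curl (u t) xs‖) →
            ∃ B : ℝ, ∀ t ∈ Ico 0 T, ∀ x, ‖curl (u t) x‖ ≤ B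

/-- Vorticity slices of a class solution are differentiable. [folklore] -/
private theorem differentiable_curl_slice {ν T : ℝ} {v₀ : E3 → E3} {u : ℝ → E3 → E3} {p : ℝ → E3 → ℝ}
    (h : IsLocalSolution ν T v₀ u p) {t : ℝ} (ht : t ∈ Ico 0 T) : Differentiable ℝ (curl (u t)) := by
  have hu : ContDiff ℝ 2 (u t) := (h.isClassical.contDiff_velocity ht).of_le (by norm_cast)
  exact (contDiff_curl (n := 1) hu).differentiable (by norm_num)

/-- **Case 2's bookkeeping holds** (p.8 l.45–84): with F(t) > 0 attained at all times and the vorticity maximum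
attained, Lemma 6.1's monotonicity and `F(t) ≥ ‖ω(·,t)‖_∞` bound the vorticity on `[0,T)` by F(0).
[cite: Zhong2026, proof of Theorem 6.2, Case 2 p.8 l.45–84] -/
theorem step_Case2_holds : Step_Case2 := by
  intro h61 hF ν hν T hT v₀ u p hsol hnv hpos hvm
  have h0 : (0 : ℝ) ∈ Ico 0 T := ⟨le_rfl, hT⟩
  obtain ⟨x0, hx0, _⟩ := hpos 0 h0
  refine ⟨floc ν (curl (u 0)) x0, fun t ht x => ?_⟩
  obtain ⟨xF, hxF, hxFpos⟩ := hpos t ht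
  obtain ⟨xs, hxs⟩ := hvm t ht
  have hne : curl (u t) xs ≠ 0 := by
    exact hnv t ht xs
  have h1 : ‖curl (u t) x‖ ≤ ‖curl (u t) xs‖ := hxs x
  have h2 : ‖curl (u t) xs‖ ≤ floc ν (curl (u t)) xF :=
    hF ν (curl (u t)) xs xF (differentiable_curl_slice hsol ht) hne hxs hxF
  have h3 : floc ν (curl (u t)) xF ≤ floc ν (curl (u 0)) x0 := by
    rcases ht.1.eq_or_lt with h00 | htpos
    · subst h00
      exact hx0 xF
    · exact (h61 ν hν T v₀ u p hsol hnv 0 h0 t ht htpos x0 hx0 (by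
        have := hx0 xF
        obtain ⟨xF0, hxF0, hxF0pos⟩ := hpos 0 h0
        exact lt_of_lt_of_le hxF0pos (hx0 xF0)) xF hxF).le
  exact h1.trans (h2.trans h3)

/-- **The two cases deliver the vorticity bound (p.8 l.40–84)**: exhaustiveness + standing hypotheses
(`Step_exhaustive`), Case 1 (via Lemma 3.1) and Case 2 (via Lemma 6.1 and `Step_Fge`). Pure logic (the case
split is `∃ t₁, F(t₁) ≤ 0` vs its negation). [cite: Zhong2026, proof of Theorem 6.2 p.8 l.40–84] -/
theorem vortBound_of_cases (h31 : Step_L31) (h61 : Step_L61) (hF : Step_Fge) (hc1 : Step_Case1)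
    (hc2 : Step_Case2) (hex : Step_exhaustive) : VortBound := by
  intro ν hν T hT v₀ u p hsol
  obtain ⟨hnv, hatt, hvm⟩ := hex ν hν T hT v₀ u p hsol
  by_cases hc : ∃ t₁ ∈ Ico 0 T, ∃ x₁, IsFMaxAt ν (curl (u t₁)) x₁ ∧ floc ν (curl (u t₁)) x₁ ≤ 0
  · exact hc1 h31 ν hν T hT v₀ u p hsol hnv hc
  · push Not at hc
    refine hc2 h61 hF ν hν T hT v₀ u p hsol hnv (fun t ht => ?_) hvm
    obtain ⟨xF, hxF⟩ := hatt t ht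
    exact ⟨xF, hxF, hc t ht xF hxF⟩

/-- **PRINT-ORDER COMPOSITION of the whole chain (pp.4–8)** — every binder is used: the sign step p.5 and (17)
give (18); the printed substitution gives (19); the Hessian bound and the geometric constraint («≤») give (20)
(arithmetic, PROVED); «Appendix B» gives (21); (21) and the geometric constraint («≥») give (27); (27) gives
Lemma 6.1; Lemma 3.1, Lemma 6.1, `Step_Fge` (PROVED), the two cases and exhaustiveness give the vorticity
bound; the local theory (tree, DISCHARGED) and BKM give Theorem 6.2. [cite: Zhong2026, §§3–4 pp.4–6; §6 p.8] -/
theorem claim_of_printed_steps (h1 : Chae2007.Step_1) (hB : Step_BKM) (hs : Step_sign) (h17 : Step_17)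
    (hsub : Step_subst19) (h43 : Step_L43) (hH : Step_Hperp) (hgl : Step_geom_le) (hApp : Step_AppB)
    (hgg : Step_geom_ge) (h27 : Step_27_of) (h61 : Step_L61_of27) (h31 : Step_L31) (hc1 : Step_Case1)
    (hc2 : Step_Case2) (hex : Step_exhaustive) : ClaimedTheorem :=
  claim_of_steps h1 hB
    (vortBound_of_cases h31 (h61 (h27 (hApp (step20_of_printed (hsub (step18_of_sign hs h17) h43) hH hgl)) hgg))
      step_Fge_holds hc1 hc2 hex)

/-- The same composition with the tree's discharged local theory and the proved Case 2 bookkeeping fed in.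
[cite: Zhong2026, §§3–6 pp.4–8] -/
theorem claim_of_printed_steps' (hB : Step_BKM) (hs : Step_sign) (h17 : Step_17) (hsub : Step_subst19)
    (h43 : Step_L43) (hH : Step_Hperp) (hgl : Step_geom_le) (hApp : Step_AppB) (hgg : Step_geom_ge)
    (h27 : Step_27_of) (h61 : Step_L61_of27) (h31 : Step_L31) (hc1 : Step_Case1) (hex : Step_exhaustive) :
    ClaimedTheorem :=
  claim_of_printed_steps Chae2007.step_1_holds hB hs h17 hsub h43 hH hgl hApp hgg h27 h61 h31 hc1
    step_Case2_holds hex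

/-- Clay (A) from the printed steps. [cite: Zhong2026, Theorem 6.2 p.8] -/
theorem clay_of_steps (h1 : Chae2007.Step_1) (hB : Step_BKM) (hV : VortBound) :
    ClayVariants.clayR3.Regularity :=
  clay_of_claimed (claim_of_steps h1 hB hV)

/-! ## REV 2 (additive, 2-READ typist-1 g5 OBSERVATION (V) 12:21:52Z): point-grain twins of the §4 faces

The print's standing hypothesis «∇ψ ≠ 0 everywhere» (p.4 l.65–66), typed verbatim in `AtPhiMax` /
`Step_L41` / `Step_L43` / `Step_Hperp`, is unsatisfiable on the class (ω ≠ 0 everywhere and |ω| → 0 at ∞ force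
an attained maximum of |ω|, where ∇ψ = 0 — `floc_at_vortMax`), so those faces are vacuously true as typed. The
print USES non-vanishing only at the maximum point x₀ of Φ (p.5 l.20–23 «|∇ψ|⁴/e^ψ (which is non-zero at x₀
since M > 0 implies e^ψ > 0 and |∇ψ| > 0)»). The `_pt` faces below carry the same displays with the
hypothesis only where the print uses it; each verbatim face follows from its `_pt` twin (`…_of_pt`, PROVED),
and `claim_of_printed_steps_pt` is the print-order composition through the `_pt` faces. Nothing above is
changed. -/

/-- At a point where Φ > 0 the gradient ∇ψ is nonzero (Φ = e^ψ/|∇ψ|² with Lean's `x / 0 = 0`); this is the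
print's «M > 0 implies … |∇ψ| > 0» at x₀ (p.5 l.20–23). [cite: Zhong2026, proof of Lemma 4.1 p.5 l.20–23] -/
theorem gpsi_ne_zero_of_phi_pos {w : E3 → E3} {x : E3} (h : 0 < Phi w x) : gpsi w x ≠ 0 := by
  intro h0
  unfold Phi at h
  rw [h0, norm_zero, zero_pow two_ne_zero, div_zero] at h
  exact lt_irrefl 0 h

/-- Point-grain frame of the dynamical §4 faces: as `AtPhiMax` without the global «∇ψ ≠ 0 everywhere»
(non-vanishing of ∇ψ at x₀ follows from Φ(x₀) > 2ν > 0). [cite: Zhong2026, §4.1 p.4 l.65–75; p.5 l.20–23] -/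
def AtPhiMaxPt (ν T : ℝ) (v₀ : E3 → E3) (u : ℝ → E3 → E3) (p : ℝ → E3 → ℝ) (t : ℝ) (x₀ : E3) : Prop :=
  IsLocalSolution ν T v₀ u p ∧ t ∈ Ioo 0 T ∧ NonVanishing (curl (u t)) ∧
    IsPhiMaxAt (curl (u t)) x₀ ∧ 2 * ν < Phi (curl (u t)) x₀

/-- The verbatim frame implies the point-grain frame. [cite: Zhong2026, §4.1 p.4 l.65–75] -/
theorem atPhiMaxPt_of_atPhiMax {ν T : ℝ} {v₀ : E3 → E3} {u : ℝ → E3 → E3} {p : ℝ → E3 → ℝ} {t : ℝ} {x₀ : E3}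
    (h : AtPhiMax ν T v₀ u p t x₀) : AtPhiMaxPt ν T v₀ u p t x₀ :=
  ⟨h.1, h.2.1, h.2.2.1, h.2.2.2.2.1, h.2.2.2.2.2⟩

/-- **Lemma 4.3 (16) p.5 l.60–71, point grain**: at a maximum point x₀ of Φ with Φ(x₀) > 0, for class fields
with ω ≠ 0 everywhere. [claim: Zhong2026, status: under-review] [cite: Zhong2026, Lemma 4.3 (16) p.5 l.60–71] -/
def Step_L43_pt : Prop :=
  ∀ v : E3 → E3, IsDatum v → NonVanishing (curl v) → ∀ x₀, IsPhiMaxAt (curl v) x₀ → 0 < Phi (curl v) x₀ →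
    lapRatio (curl v) x₀ ≤ 2 * frobeniusNormSq (hessPsi (curl v) x₀) / ‖gpsi (curl v) x₀‖ ^ 2

/-- The verbatim (16) face from its point-grain twin. [cite: Zhong2026, Lemma 4.3 (16) p.5] -/
theorem stepL43_of_pt (h : Step_L43_pt) : Step_L43 := by
  intro v hv hnv _hg x₀ hmax
  by_cases hΦ : 0 < Phi (curl v) x₀
  · exact h v hv hnv x₀ hmax hΦ
  · -- Φ(x₀) ≤ 0 contradicts «∇ψ ≠ 0 everywhere»: Φ = e^ψ/|∇ψ|² > 0 wherever ∇ψ ≠ 0.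
    exact absurd (div_pos (Real.exp_pos _) (by
      have := norm_pos_iff.mpr (_hg x₀)
      positivity)) hΦ

/-- **THE SIGN STEP p.5 l.83–85, point grain**: «Hence Dψ/Dt(x₀) ≤ 0» in the frame `AtPhiMaxPt`.
[claim: Zhong2026, status: under-review] [cite: Zhong2026, §4.3 p.5 l.83–85] -/
def Step_sign_pt : Prop :=
  ∀ (ν T : ℝ) (v₀ : E3 → E3) (u : ℝ → E3 → E3) (p : ℝ → E3 → ℝ) (t : ℝ) (x₀ : E3), 0 < ν →
    AtPhiMaxPt ν T v₀ u p t x₀ → matDpsi u t x₀ ≤ 0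

/-- The verbatim sign face from its point-grain twin. [cite: Zhong2026, §4.3 p.5 l.83–85] -/
theorem stepSign_of_pt (h : Step_sign_pt) : Step_sign :=
  fun ν T v₀ u p t x₀ hν hA => h ν T v₀ u p t x₀ hν (atPhiMaxPt_of_atPhiMax hA)

/-- **(18) p.5 l.85–92, point grain.** [claim: Zhong2026, status: under-review] [cite: Zhong2026, (18) p.5 l.85–92] -/
def Step_18_pt : Prop :=
  ∀ (ν T : ℝ) (v₀ : E3 → E3) (u : ℝ → E3 → E3) (p : ℝ → E3 → ℝ) (t : ℝ) (x₀ : E3), 0 < ν →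
    AtPhiMaxPt ν T v₀ u p t x₀ →
      S0 (u t) x₀ ≤ -ν * lapRatio (curl (u t)) x₀ + ν * ‖gpsi (curl (u t)) x₀‖ ^ 2 + ν * gradDirSq (curl (u t)) x₀

/-- (18) point grain from the sign step (point grain) and (17). [cite: Zhong2026, (17)–(18) p.5 l.72–92] -/
theorem step18_pt_of_sign_pt (hs : Step_sign_pt) (h17 : Step_17) : Step_18_pt := by
  intro ν T v₀ u p t x₀ hν hA
  have hle := hs ν T v₀ u p t x₀ hν hA
  rw [h17 ν hν T v₀ u p hA.1 t hA.2.1 hA.2.2.1 x₀] at hle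
  linarith

/-- **(19) p.6 l.2–9, point grain.** [claim: Zhong2026, status: under-review] [cite: Zhong2026, (19) p.6 l.2–9] -/
def Step_19_pt : Prop :=
  ∀ (ν T : ℝ) (v₀ : E3 → E3) (u : ℝ → E3 → E3) (p : ℝ → E3 → ℝ) (t : ℝ) (x₀ : E3), 0 < ν →
    AtPhiMaxPt ν T v₀ u p t x₀ →
      S0 (u t) x₀ ≤ 2 * ν * frobeniusNormSq (hessPsi (curl (u t)) x₀) / ‖gpsi (curl (u t)) x₀‖ ^ 2 +
        ν * ‖gpsi (curl (u t)) x₀‖ ^ 2 + ν * gradDirSq (curl (u t)) x₀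

/-- **The substitution p.6 l.2 as printed, point grain**: (18) and (16) give (19).
[claim: Zhong2026, status: under-review] [cite: Zhong2026, p.6 l.2–9] -/
def Step_subst19_pt : Prop :=
  Step_18_pt → Step_L43_pt → Step_19_pt

/-- **p.6 l.23–45, point grain**: |∇²ψ|²_F ≤ (7/16)|∇ψ|⁴ at a maximum point x₀ of Φ with Φ(x₀) > 0.
[claim: Zhong2026, status: under-review] [cite: Zhong2026, §4.3 p.6 l.23–45] -/
def Step_Hperp_pt : Prop :=
  ∀ v : E3 → E3, IsDatum v → NonVanishing (curl v) → ∀ x₀, IsPhiMaxAt (curl v) x₀ → 0 < Phi (curl v) x₀ →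
    frobeniusNormSq (hessPsi (curl v) x₀) ≤ 7 / 16 * ‖gpsi (curl v) x₀‖ ^ 4

/-- **(20) p.6 l.63–77, point grain.** [claim: Zhong2026, status: under-review] [cite: Zhong2026, (20) p.6 l.63–77] -/
def Step_20_pt : Prop :=
  ∀ (ν T : ℝ) (v₀ : E3 → E3) (u : ℝ → E3 → E3) (p : ℝ → E3 → ℝ) (t : ℝ) (x₀ : E3), 0 < ν →
    AtPhiMaxPt ν T v₀ u p t x₀ → S0 (u t) x₀ ≤ 53 / 24 * ν * ‖gpsi (curl (u t)) x₀‖ ^ 2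

/-- (20) point grain from (19), the Hessian bound and the geometric constraint («≤»), all point grain —
real arithmetic. [cite: Zhong2026, (19)–(20) p.6 l.2–77] -/
theorem step20_pt_of_printed (h19 : Step_19_pt) (hH : Step_Hperp_pt) (hg : Step_geom_le) : Step_20_pt := by
  intro ν T v₀ u p t x₀ hν hA
  obtain ⟨hsol, ht, hnv, hmax, hF⟩ := hA
  have hdat : IsDatum (u t) := isDatum_slice hsol ht
  have hΦ : 0 < Phi (curl (u t)) x₀ := lt_trans (by positivity) hF
  have h1 := h19 ν T v₀ u p t x₀ hν ⟨hsol, ht, hnv, hmax, hF⟩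
  have h2 := hH (u t) hdat hnv x₀ hmax hΦ
  have h3 := hg (u t) hdat hnv x₀
  set g : ℝ := ‖gpsi (curl (u t)) x₀‖ with hg_def
  have hgpos : 0 < g := norm_pos_iff.mpr (gpsi_ne_zero_of_phi_pos hΦ)
  have hg2 : 0 < g ^ 2 := by positivity
  have hfrac : 2 * ν * frobeniusNormSq (hessPsi (curl (u t)) x₀) / g ^ 2 ≤ 7 / 8 * ν * g ^ 2 := by
    rw [div_le_iff₀ hg2]
    have : 2 * ν * frobeniusNormSq (hessPsi (curl (u t)) x₀) ≤ 2 * ν * (7 / 16 * g ^ 4) :=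
      mul_le_mul_of_nonneg_left h2 (by positivity)
    nlinarith [this]
  have hgeom : ν * gradDirSq (curl (u t)) x₀ ≤ ν * (1 / 3 * g ^ 2) := mul_le_mul_of_nonneg_left h3 hν.le
  linarith [h1, hfrac, hgeom]

/-- **(21) p.6 l.78–87, point grain**: «S₀(x₀) ≤ ½ν|∇ψ(x₀)|²» in the frame `AtPhiMaxPt`.
[claim: Zhong2026, status: under-review] [cite: Zhong2026, (21) p.6 l.78–87; §4 p.4 l.58–64] -/
def Step_21_pt : Prop :=
  ∀ (ν T : ℝ) (v₀ : E3 → E3) (u : ℝ → E3 → E3) (p : ℝ → E3 → ℝ) (t : ℝ) (x₀ : E3), 0 < ν →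
    AtPhiMaxPt ν T v₀ u p t x₀ → S0 (u t) x₀ ≤ 1 / 2 * ν * ‖gpsi (curl (u t)) x₀‖ ^ 2

/-- The verbatim (21) face from its point-grain twin. [cite: Zhong2026, (21) p.6 l.78–87] -/
theorem step21_of_pt (h : Step_21_pt) : Step_21 :=
  fun ν T v₀ u p t x₀ hν hA => h ν T v₀ u p t x₀ hν (atPhiMaxPt_of_atPhiMax hA)

/-- **«Appendix B» step p.6 l.78–87, point grain**: (20) ⇒ (21).
[claim: Zhong2026, status: under-review] [cite: Zhong2026, p.6 l.78–87; Appendix B p.10 l.30–70] -/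
def Step_AppB_pt : Prop :=
  Step_20_pt → Step_21_pt

/-- **PRINT-ORDER COMPOSITION through the point-grain §4 faces** (every binder used): as
`claim_of_printed_steps`, with the sign step, (18)–(21), (16), the Hessian bound and «Appendix B» at point
grain; (21) point grain gives the verbatim (21), which feeds Lemma 6.1 as printed. [cite: Zhong2026, §§3–6 pp.4–8] -/
theorem claim_of_printed_steps_pt (h1 : Chae2007.Step_1) (hB : Step_BKM) (hs : Step_sign_pt) (h17 : Step_17)
    (hsub : Step_subst19_pt) (h43 : Step_L43_pt) (hH : Step_Hperp_pt) (hgl : Step_geom_le) (hApp : Step_AppB_pt)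
    (hgg : Step_geom_ge) (h27 : Step_27_of) (h61 : Step_L61_of27) (h31 : Step_L31) (hc1 : Step_Case1)
    (hc2 : Step_Case2) (hex : Step_exhaustive) : ClaimedTheorem :=
  claim_of_steps h1 hB
    (vortBound_of_cases h31
      (h61 (h27 (step21_of_pt (hApp (step20_pt_of_printed (hsub (step18_pt_of_sign_pt hs h17) h43) hH hgl)))
        hgg))
      step_Fge_holds hc1 hc2 hex)

/-! ## REV 3 (additive, REF-1 REV-2 CAUTION 12:28:09Z): LOCAL-maximum grain of the §4 faces

`Phi = e^ψ/|∇ψ|²` is unbounded near any maximiser of |ω| (∇ψ → 0 there), so «M = sup Φ … attained at an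
interior point x₀» (p.4 l.69–75) — the frame of `AtPhiMax` / `AtPhiMaxPt` — is unsatisfiable on the class and
the faces under it are vacuous. Lemma 4.1 (14) / Lemma 4.3 (16) use only LOCAL maximality of Φ at x₀; the
`_loc` faces below carry the printed displays at a local maximum point x₀ of Φ(·,t) with ω(x₀) ≠ 0,
∇ψ(x₀) ≠ 0 and Φ(x₀) > 2ν (REF-1's `AtPhiLocalMaxPt`), the geometric constraint pointwise where ω(x) ≠ 0, and
(17) at such points. Implications `_loc ⇒ _pt` are PROVED where the frames nest (a global maximum is a local
one), and `claim_of_printed_steps_loc` is the print-order composition through the `_loc` faces. Nothing above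
is changed. -/

/-- LOCAL-maximum frame of the dynamical §4 faces (REF-1 12:28:09Z): a class solution on `[0,T)`, an interior
time, a point x₀ with ω(x₀) ≠ 0, ∇ψ(x₀) ≠ 0, Φ(·,t) locally maximal at x₀ and Φ(x₀) > 2ν.
[cite: Zhong2026, §4.1 p.4 l.65–75; Lemma 4.1 p.5 l.2–23 (local first/second-order conditions)] -/
def AtPhiLocMax (ν T : ℝ) (v₀ : E3 → E3) (u : ℝ → E3 → E3) (p : ℝ → E3 → ℝ) (t : ℝ) (x₀ : E3) : Prop :=
  IsLocalSolution ν T v₀ u p ∧ t ∈ Ioo 0 T ∧ curl (u t) x₀ ≠ 0 ∧ gpsi (curl (u t)) x₀ ≠ 0 ∧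
    IsLocalMax (Phi (curl (u t))) x₀ ∧ 2 * ν < Phi (curl (u t)) x₀

/-- The point-grain (global-maximum) frame implies the local-maximum frame. [cite: Zhong2026, §4.1 p.4 l.65–75] -/
theorem atPhiLocMax_of_atPhiMaxPt {ν T : ℝ} {v₀ : E3 → E3} {u : ℝ → E3 → E3} {p : ℝ → E3 → ℝ} {t : ℝ}
    {x₀ : E3} (hν : 0 < ν) (h : AtPhiMaxPt ν T v₀ u p t x₀) : AtPhiLocMax ν T v₀ u p t x₀ := by
  obtain ⟨hsol, ht, hnv, hmax, hF⟩ := h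
  have hΦ : 0 < Phi (curl (u t)) x₀ := lt_trans (by positivity) hF
  exact ⟨hsol, ht, hnv x₀, gpsi_ne_zero_of_phi_pos hΦ, Filter.Eventually.of_forall fun x => hmax x, hF⟩

/-- **(17) p.5 l.72–82 at points with ω(x) ≠ 0** (no global non-vanishing): the |ω|-transport identity for
Dψ/Dt along class solutions at interior times. TRUE-type. [claim: Zhong2026, status: under-review] [cite: Zhong2026, (17) p.5 l.72–82] -/
def Step_17_loc : Prop :=
  ∀ ν : ℝ, 0 < ν → ∀ (T : ℝ) (v₀ : E3 → E3) (u : ℝ → E3 → E3) (p : ℝ → E3 → ℝ), IsLocalSolution ν T v₀ u p →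
    ∀ t ∈ Ioo 0 T, ∀ x, curl (u t) x ≠ 0 →
      matDpsi u t x = S0 (u t) x + ν * lapRatio (curl (u t)) x - ν * ‖gpsi (curl (u t)) x‖ ^ 2 -
        ν * gradDirSq (curl (u t)) x

/-- (17) pointwise gives (17) under global non-vanishing. [cite: Zhong2026, (17) p.5 l.72–82] -/
theorem step17_of_loc (h : Step_17_loc) : Step_17 :=
  fun ν hν T v₀ u p hsol t ht hnv x => h ν hν T v₀ u p hsol t ht x (hnv x)

/-- **THE SIGN STEP p.5 l.83–85, local-maximum grain**: «At the global maximum point x₀, the material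
derivative must be non-positive … Hence Dψ/Dt(x₀) ≤ 0», read at a local maximum point of Φ(·,t) (frame
`AtPhiLocMax`). [claim: Zhong2026, status: under-review] [cite: Zhong2026, §4.3 p.5 l.83–85] -/
def Step_sign_loc : Prop :=
  ∀ (ν T : ℝ) (v₀ : E3 → E3) (u : ℝ → E3 → E3) (p : ℝ → E3 → ℝ) (t : ℝ) (x₀ : E3), 0 < ν →
    AtPhiLocMax ν T v₀ u p t x₀ → matDpsi u t x₀ ≤ 0

/-- The point-grain sign face from the local-grain one. [cite: Zhong2026, §4.3 p.5 l.83–85] -/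
theorem stepSignPt_of_loc (h : Step_sign_loc) : Step_sign_pt :=
  fun ν T v₀ u p t x₀ hν hA => h ν T v₀ u p t x₀ hν (atPhiLocMax_of_atPhiMaxPt hν hA)

/-- **(18) p.5 l.85–92, local-maximum grain.** [claim: Zhong2026, status: under-review] [cite: Zhong2026, (18) p.5 l.85–92] -/
def Step_18_loc : Prop :=
  ∀ (ν T : ℝ) (v₀ : E3 → E3) (u : ℝ → E3 → E3) (p : ℝ → E3 → ℝ) (t : ℝ) (x₀ : E3), 0 < ν →
    AtPhiLocMax ν T v₀ u p t x₀ →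
      S0 (u t) x₀ ≤ -ν * lapRatio (curl (u t)) x₀ + ν * ‖gpsi (curl (u t)) x₀‖ ^ 2 + ν * gradDirSq (curl (u t)) x₀

/-- (18) local grain from the sign step (local grain) and (17) (pointwise). [cite: Zhong2026, (17)–(18) p.5 l.72–92] -/
theorem step18_loc_of_sign_loc (hs : Step_sign_loc) (h17 : Step_17_loc) : Step_18_loc := by
  intro ν T v₀ u p t x₀ hν hA
  have hle := hs ν T v₀ u p t x₀ hν hA
  rw [h17 ν hν T v₀ u p hA.1 t hA.2.1 x₀ hA.2.2.1] at hle
  linarith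

/-- **Lemma 4.3 (16) p.5 l.60–71, local-maximum grain** (field level): at a local maximum point x₀ of Φ with
ω(x₀) ≠ 0 and ∇ψ(x₀) ≠ 0, «∆e^ψ/e^ψ ≤ 2|∇²ψ|²/|∇ψ|²». TRUE-type (second-order condition), recorded as a
binder. [claim: Zhong2026, status: under-review] [cite: Zhong2026, Lemma 4.3 (16) p.5 l.60–71] -/
def Step_L43_loc : Prop :=
  ∀ v : E3 → E3, IsDatum v → ∀ x₀, curl v x₀ ≠ 0 → gpsi (curl v) x₀ ≠ 0 → IsLocalMax (Phi (curl v)) x₀ →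
    lapRatio (curl v) x₀ ≤ 2 * frobeniusNormSq (hessPsi (curl v) x₀) / ‖gpsi (curl v) x₀‖ ^ 2

/-- **(19) p.6 l.2–9, local-maximum grain.** [claim: Zhong2026, status: under-review] [cite: Zhong2026, (19) p.6 l.2–9] -/
def Step_19_loc : Prop :=
  ∀ (ν T : ℝ) (v₀ : E3 → E3) (u : ℝ → E3 → E3) (p : ℝ → E3 → ℝ) (t : ℝ) (x₀ : E3), 0 < ν →
    AtPhiLocMax ν T v₀ u p t x₀ →
      S0 (u t) x₀ ≤ 2 * ν * frobeniusNormSq (hessPsi (curl (u t)) x₀) / ‖gpsi (curl (u t)) x₀‖ ^ 2 +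
        ν * ‖gpsi (curl (u t)) x₀‖ ^ 2 + ν * gradDirSq (curl (u t)) x₀

/-- **The substitution p.6 l.2 as printed, local-maximum grain**: (18) and (16) give (19).
[claim: Zhong2026, status: under-review] [cite: Zhong2026, p.6 l.2–9] -/
def Step_subst19_loc : Prop :=
  Step_18_loc → Step_L43_loc → Step_19_loc

/-- **p.6 l.23–45, local-maximum grain** (field level): «‖H⊥‖²_F ≤ (3/16)|∇ψ|⁴ … |∇²ψ|² ≤ (7/16)|∇ψ|⁴» at a
local maximum point x₀ of Φ with ω(x₀) ≠ 0, ∇ψ(x₀) ≠ 0. [claim: Zhong2026, status: under-review] [cite: Zhong2026, §4.3 p.6 l.23–45] -/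
def Step_Hperp_loc : Prop :=
  ∀ v : E3 → E3, IsDatum v → ∀ x₀, curl v x₀ ≠ 0 → gpsi (curl v) x₀ ≠ 0 → IsLocalMax (Phi (curl v)) x₀ →
    frobeniusNormSq (hessPsi (curl v) x₀) ≤ 7 / 16 * ‖gpsi (curl v) x₀‖ ^ 4

/-- **The geometric constraint p.6 l.53–62 («≤ ⅓»), pointwise where ω(x) ≠ 0** (no global non-vanishing).
[claim: Zhong2026, status: under-review] [cite: Zhong2026, §4.3 p.6 l.53–62] -/
def Step_geom_le_loc : Prop :=
  ∀ v : E3 → E3, IsDatum v → ∀ x, curl v x ≠ 0 → gradDirSq (curl v) x ≤ 1 / 3 * ‖gpsi (curl v) x‖ ^ 2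

/-- The pointwise geometric constraint gives the version under global non-vanishing. [cite: Zhong2026, p.6 l.53–62] -/
theorem stepGeomLe_of_loc (h : Step_geom_le_loc) : Step_geom_le :=
  fun v hv hnv x => h v hv x (hnv x)

/-- **The geometric constraint as printed on p.8 l.15–21 («≥ ⅓»), pointwise where ω(x) ≠ 0.**
[claim: Zhong2026, status: under-review] [cite: Zhong2026, proof of Lemma 6.1 p.8 l.15–21] -/
def Step_geom_ge_loc : Prop :=
  ∀ v : E3 → E3, IsDatum v → ∀ x, curl v x ≠ 0 → 1 / 3 * ‖gpsi (curl v) x‖ ^ 2 ≤ gradDirSq (curl v) x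

/-- The pointwise «≥» constraint gives the version under global non-vanishing. [cite: Zhong2026, p.8 l.15–21] -/
theorem stepGeomGe_of_loc (h : Step_geom_ge_loc) : Step_geom_ge :=
  fun v hv hnv x => h v hv x (hnv x)

/-- **(20) p.6 l.63–77, local-maximum grain.** [claim: Zhong2026, status: under-review] [cite: Zhong2026, (20) p.6 l.63–77] -/
def Step_20_loc : Prop :=
  ∀ (ν T : ℝ) (v₀ : E3 → E3) (u : ℝ → E3 → E3) (p : ℝ → E3 → ℝ) (t : ℝ) (x₀ : E3), 0 < ν →
    AtPhiLocMax ν T v₀ u p t x₀ → S0 (u t) x₀ ≤ 53 / 24 * ν * ‖gpsi (curl (u t)) x₀‖ ^ 2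

/-- (20) local grain from (19), the Hessian bound and the geometric constraint, all local/pointwise —
real arithmetic. [cite: Zhong2026, (19)–(20) p.6 l.2–77] -/
theorem step20_loc_of_printed (h19 : Step_19_loc) (hH : Step_Hperp_loc) (hg : Step_geom_le_loc) :
    Step_20_loc := by
  intro ν T v₀ u p t x₀ hν hA
  obtain ⟨hsol, ht, hne, hgne, hmax, hF⟩ := hA
  have hdat : IsDatum (u t) := isDatum_slice hsol ht
  have h1 := h19 ν T v₀ u p t x₀ hν ⟨hsol, ht, hne, hgne, hmax, hF⟩
  have h2 := hH (u t) hdat x₀ hne hgne hmax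
  have h3 := hg (u t) hdat x₀ hne
  set g : ℝ := ‖gpsi (curl (u t)) x₀‖ with hg_def
  have hgpos : 0 < g := norm_pos_iff.mpr hgne
  have hg2 : 0 < g ^ 2 := by positivity
  have hfrac : 2 * ν * frobeniusNormSq (hessPsi (curl (u t)) x₀) / g ^ 2 ≤ 7 / 8 * ν * g ^ 2 := by
    rw [div_le_iff₀ hg2]
    have : 2 * ν * frobeniusNormSq (hessPsi (curl (u t)) x₀) ≤ 2 * ν * (7 / 16 * g ^ 4) :=
      mul_le_mul_of_nonneg_left h2 (by positivity)
    nlinarith [this]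
  have hgeom : ν * gradDirSq (curl (u t)) x₀ ≤ ν * (1 / 3 * g ^ 2) := mul_le_mul_of_nonneg_left h3 hν.le
  linarith [h1, hfrac, hgeom]

/-- **(21) p.6 l.78–87, local-maximum grain**: «S₀(x₀) ≤ ½ν|∇ψ(x₀)|²» in the frame `AtPhiLocMax`.
[claim: Zhong2026, status: under-review] [cite: Zhong2026, (21) p.6 l.78–87; §4 p.4 l.58–64; abstract p.1] -/
def Step_21_loc : Prop :=
  ∀ (ν T : ℝ) (v₀ : E3 → E3) (u : ℝ → E3 → E3) (p : ℝ → E3 → ℝ) (t : ℝ) (x₀ : E3), 0 < ν →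
    AtPhiLocMax ν T v₀ u p t x₀ → S0 (u t) x₀ ≤ 1 / 2 * ν * ‖gpsi (curl (u t)) x₀‖ ^ 2

/-- The point-grain (21) face from the local-grain one. [cite: Zhong2026, (21) p.6 l.78–87] -/
theorem step21Pt_of_loc (h : Step_21_loc) : Step_21_pt :=
  fun ν T v₀ u p t x₀ hν hA => h ν T v₀ u p t x₀ hν (atPhiLocMax_of_atPhiMaxPt hν hA)

/-- **«Appendix B» step p.6 l.78–87, local-maximum grain**: (20) ⇒ (21).
[claim: Zhong2026, status: under-review] [cite: Zhong2026, p.6 l.78–87; Appendix B p.10 l.30–70] -/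
def Step_AppB_loc : Prop :=
  Step_20_loc → Step_21_loc

/-- **The derivation of (27), p.8 l.13–22, from the local-grain (21) and the pointwise «≥» constraint**
(typed as the inference, as `Step_27_of`). [claim: Zhong2026, status: under-review] [cite: Zhong2026, proof of Lemma 6.1 p.8 l.13–22] -/
def Step_27_of_loc : Prop :=
  Step_21_loc → Step_geom_ge_loc → Step_27

/-- **PRINT-ORDER COMPOSITION through the local-maximum-grain §4 faces** (every binder used): the sign step,
(17), (18)–(21), (16), the Hessian bound, both geometric printings and «Appendix B» at local/pointwise grain;
then (27), Lemma 6.1, Lemma 3.1, the two cases, exhaustiveness, BKM and the tree's local theory as before.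
[cite: Zhong2026, §§3–6 pp.4–8] -/
theorem claim_of_printed_steps_loc (h1 : Chae2007.Step_1) (hB : Step_BKM) (hs : Step_sign_loc)
    (h17 : Step_17_loc) (hsub : Step_subst19_loc) (h43 : Step_L43_loc) (hH : Step_Hperp_loc)
    (hgl : Step_geom_le_loc) (hApp : Step_AppB_loc) (hgg : Step_geom_ge_loc) (h27 : Step_27_of_loc)
    (h61 : Step_L61_of27) (h31 : Step_L31) (hc1 : Step_Case1) (hc2 : Step_Case2) (hex : Step_exhaustive) :
    ClaimedTheorem :=
  claim_of_steps h1 hB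
    (vortBound_of_cases h31
      (h61 (h27 (hApp (step20_loc_of_printed (hsub (step18_loc_of_sign_loc hs h17) h43) hH hgl)) hgg))
      step_Fge_holds hc1 hc2 hex)


open Metric

/-! ## REV 4 (additive; ns-claims-typist-1 g5, literature-prover D-0026 pass, GO typist-9 g5 13:10:07Z): the
## vacuity of the verbatim (rev 1) and point-grain (rev 2) §4 frames, IN THE KERNEL

Nothing above is changed. New imports: `FunctionSpaces.SobolevHolderDomain` (Adams' Hölder embedding) and
`FluidPDE.ConstantinFeffermanEnstrophySlab` (`‖Dʲ curl v‖ ≤ ‖curl‖‖Dʲ⁺¹ v‖`). Content: (i) decay of the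
vorticity of a class field at infinity and ATTAINMENT of its maximum (`exists_norm_curl_lt`,
`exists_forall_norm_curl_le`); (ii) `not_gradNonVanishing` / `atPhiMax_false` — the frame of the rev-1 faces is
empty; (iii) `not_isPhiMaxAt` / `atPhiMaxPt_false` — Φ has no global maximiser, the frame of the rev-2 `_pt`
faces is empty; (iv) the corresponding `…_holds` theorems, each VACUOUS and labelled so. The live, non-vacuous
faces are the rev-3 `_loc` ones, `Step_geom_le/ge(_loc)`, `Step_27`, `Step_L61(_of27)`, and the refuted
`Step_exhaustive`. WHAT THIS IS NOT: not a claim about NS regularity or blow-up; not a claim about any author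
beyond the typed locator. -/


/-- The `L²` Sobolev seminorms of the vorticity of a smooth field all of whose derivatives are square
integrable are finite (`‖Dʲ curl v‖ ≤ ‖curl‖·‖Dʲ⁺¹v‖`, tree `norm_iteratedFDeriv_curl_le_opNorm_mul`). [folklore] -/
private theorem eLpNorm_iteratedFDeriv_curl_lt_top {v : E3 → E3} (hv : ContDiff ℝ ∞ v)
    (hS : ∀ n : ℕ, ∫⁻ x, ‖iteratedFDeriv ℝ n v x‖ₑ ^ 2 < ⊤) (j : ℕ) :
    eLpNorm (iteratedFDeriv ℝ j (curl v)) 2 volume < ⊤ := by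
  have hpt : ∀ x, ‖iteratedFDeriv ℝ j (curl v) x‖ ≤ ‖curlCLM‖ * ‖iteratedFDeriv ℝ (j + 1) v x‖ :=
    fun x => norm_iteratedFDeriv_curl_le_opNorm_mul (N := ⊤) hv j (by exact_mod_cast le_top) x
  have hcont : Continuous (iteratedFDeriv ℝ (j + 1) v) :=
    hv.continuous_iteratedFDeriv (by exact_mod_cast le_top)
  have hmem : MemLp (iteratedFDeriv ℝ (j + 1) v) 2 volume := by
    refine ⟨hcont.aestronglyMeasurable, ?_⟩
    rw [eLpNorm_lt_top_iff_lintegral_rpow_enorm_lt_top two_ne_zero ENNReal.ofNat_ne_top]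
    simpa using hS (j + 1)
  have h1 : MemLp (fun x => ‖curlCLM‖ * ‖iteratedFDeriv ℝ (j + 1) v x‖) 2 volume :=
    hmem.norm.const_mul _
  have hmeas : AEStronglyMeasurable (iteratedFDeriv ℝ j (curl v)) volume :=
    ((contDiff_curl (n := ⊤) (by simpa using hv)).continuous_iteratedFDeriv
      (by exact_mod_cast le_top)).aestronglyMeasurable
  exact (h1.mono' hmeas (Eventually.of_forall hpt)).eLpNorm_lt_top

/-- **Decay of the vorticity at infinity** for a smooth field with square-integrable derivatives of all orders
(the class `Chae2007.IsDatum` / the slices of `IsLocalSolution`): `∀ ε > 0 ∃ R, ‖x‖ > R ⇒ |curl v(x)| < ε`.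
Proof: the Hölder modulus `W^{2,2}(ℝ³) ⊂ C^{0,1/2}` (Adams 1975 Thm 5.4 II C'; tree
`FunctionSpaces.exists_enorm_sub_le_sobolev_two_two_dim_three`) makes `|curl v| ≥ ε/2` on a ball of fixed radius
around any point where `|curl v| ≥ ε`, whose `L²`-mass the tail of `∫|curl v|²` (dominated convergence) cannot
carry far out. [cite: Adams1975, Thm. 5.4 Part II Case C' (m = p = 2, n = 3)] -/
theorem exists_norm_curl_lt {v : E3 → E3} (hv : ContDiff ℝ ∞ v)
    (hS : ∀ n : ℕ, ∫⁻ x, ‖iteratedFDeriv ℝ n v x‖ₑ ^ 2 < ⊤) {ε : ℝ} (hε : 0 < ε) :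
    ∃ R : ℝ, ∀ x : E3, R < ‖x‖ → ‖curl v x‖ < ε := by
  have hgc : ContDiff ℝ 2 (curl v) := contDiff_curl (n := 2) (hv.of_le (by norm_cast))
  have hgcont : Continuous (curl v) := hgc.continuous
  -- Hölder modulus (Adams Thm 5.4 II C'), in real form
  obtain ⟨K, hK, hmod⟩ := Literature.Analysis.FunctionSpaces.exists_enorm_sub_le_sobolev_two_two_dim_three
    (E := E3) (F := E3) (μ := (volume : Measure E3)) finrank_euclideanSpace_fin
  have hM : (∑ j ∈ Finset.range 3, eLpNorm (iteratedFDeriv ℝ j (curl v)) 2 volume) < ⊤ :=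
    ENNReal.sum_lt_top.2 fun j _ => eLpNorm_iteratedFDeriv_curl_lt_top hv hS j
  have hKM : K * (∑ j ∈ Finset.range 3, eLpNorm (iteratedFDeriv ℝ j (curl v)) 2 volume) ≠ ⊤ :=
    (ENNReal.mul_lt_top hK hM).ne
  set A : ℝ := (K * ∑ j ∈ Finset.range 3, eLpNorm (iteratedFDeriv ℝ j (curl v)) 2 volume).toReal with hA
  have hA0 : 0 ≤ A := ENNReal.toReal_nonneg
  have hmodR : ∀ x y : E3, ‖curl v x - curl v y‖ ≤ A * dist x y ^ (1 / 2 : ℝ) := by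
    intro x y
    have h := hmod (curl v) hgc x y
    rw [edist_dist, ENNReal.ofReal_rpow_of_nonneg dist_nonneg (by norm_num : (0:ℝ) ≤ 1 / 2),
      ← ENNReal.ofReal_toReal hKM, ← hA, ← ENNReal.ofReal_mul hA0, ← ofReal_norm] at h
    exact (ENNReal.ofReal_le_ofReal_iff (by positivity)).1 h
  -- `‖g‖² ∈ L¹`
  have hI : ∫⁻ x, ‖curl v x‖ₑ ^ 2 < ⊤ := by
    have h0 := eLpNorm_iteratedFDeriv_curl_lt_top hv hS 0
    rw [eLpNorm_lt_top_iff_lintegral_rpow_enorm_lt_top two_ne_zero ENNReal.ofNat_ne_top] at h0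
    have heq : ∀ x, ‖iteratedFDeriv ℝ 0 (curl v) x‖ₑ = ‖curl v x‖ₑ := fun x => by
      rw [← ofReal_norm, norm_iteratedFDeriv_zero, ofReal_norm]
    simpa [heq] using h0
  -- the tail of `∫ ‖g‖²` outside large balls tends to `0` (dominated convergence)
  have hmeas : Measurable fun x => ‖curl v x‖ₑ ^ 2 := hgcont.measurable.enorm.pow_const 2
  have htail : Tendsto (fun R : ℝ => ∫⁻ x in (closedBall (0 : E3) R)ᶜ, ‖curl v x‖ₑ ^ 2) atTop (𝓝 0) := by
    have key := tendsto_lintegral_filter_of_dominated_convergence (μ := (volume : Measure E3))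
      (l := atTop) (F := fun R x => ((closedBall (0 : E3) R)ᶜ).indicator (fun x => ‖curl v x‖ₑ ^ 2) x)
      (f := fun _ => 0) (fun x => ‖curl v x‖ₑ ^ 2)
      (Eventually.of_forall fun R => hmeas.indicator measurableSet_closedBall.compl)
      (Eventually.of_forall fun R => Eventually.of_forall fun x =>
        indicator_le_self _ _ x)
      hI.ne
      (Eventually.of_forall fun x => by
        refine tendsto_const_nhds.congr' ?_
        filter_upwards [eventually_ge_atTop ‖x‖] with R hR
        rw [indicator_of_notMem]
        simpa [mem_closedBall_zero_iff] using hR)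
    simp only [lintegral_zero] at key
    refine key.congr fun R => ?_
    exact lintegral_indicator measurableSet_closedBall.compl _
  -- the modulus scale `δ` and the mass `c` of a ball where `‖g‖ ≥ ε/2`
  set s : ℝ := ε / (2 * (A + 1)) with hs
  have hs0 : 0 < s := by positivity
  set δ : ℝ := s ^ 2 with hδ
  have hδ0 : 0 < δ := by positivity
  set c : ℝ≥0∞ := ENNReal.ofReal ((ε / 2) ^ 2) * volume (ball (0 : E3) δ) with hc
  have hc0 : 0 < c := ENNReal.mul_pos (ENNReal.ofReal_pos.2 (by positivity)).ne'
    (measure_ball_pos volume (0 : E3) hδ0).ne'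
  obtain ⟨R₀, hR₀⟩ := eventually_atTop.1 (htail.eventually (gt_mem_nhds hc0))
  refine ⟨R₀ + δ, fun x hx => ?_⟩
  by_contra hge
  rw [not_lt] at hge
  -- on `ball x δ`, `‖g‖ ≥ ε/2`
  have hball : ∀ y ∈ ball x δ, ε / 2 ≤ ‖curl v y‖ := by
    intro y hy
    have hd : dist x y < δ := by rw [dist_comm]; exact mem_ball.1 hy
    have h1 := hmodR x y
    have h2 : dist x y ^ (1 / 2 : ℝ) ≤ s := by
      have h3 : dist x y ^ (1 / 2 : ℝ) < δ ^ (1 / 2 : ℝ) :=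
        Real.rpow_lt_rpow dist_nonneg hd (by norm_num)
      have h3' : δ ^ (1 / 2 : ℝ) = s := by
        rw [hδ, ← Real.sqrt_eq_rpow, Real.sqrt_sq hs0.le]
      rw [h3'] at h3
      exact h3.le
    have h4 : A * dist x y ^ (1 / 2 : ℝ) ≤ ε / 2 := by
      calc A * dist x y ^ (1 / 2 : ℝ) ≤ A * s := by gcongr
        _ ≤ (A + 1) * s := by gcongr; linarith
        _ = ε / 2 := by rw [hs]; field_simp
    have h5 : ‖curl v x‖ ≤ ‖curl v y‖ + ‖curl v x - curl v y‖ := norm_le_insert' (curl v x) (curl v y)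
    linarith
  -- lower bound for the mass on the ball
  have hlow : c ≤ ∫⁻ y in ball x δ, ‖curl v y‖ₑ ^ 2 := by
    have hvol : volume (ball x δ) = volume (ball (0 : E3) δ) := by
      rw [Measure.addHaar_ball_center]
    calc c = ∫⁻ _ in ball x δ, ENNReal.ofReal ((ε / 2) ^ 2) := by
          rw [setLIntegral_const, hvol]
      _ ≤ ∫⁻ y in ball x δ, ‖curl v y‖ₑ ^ 2 := by
          refine setLIntegral_mono' measurableSet_ball fun y hy => ?_
          rw [← ofReal_norm, ← ENNReal.ofReal_pow (norm_nonneg _)]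
          exact ENNReal.ofReal_le_ofReal (pow_le_pow_left₀ (by positivity) (hball y hy) 2)
  -- upper bound: the ball lies outside `closedBall 0 R₀`
  have hsub : ball x δ ⊆ (closedBall (0 : E3) R₀)ᶜ := by
    intro y hy
    have hd : dist y x < δ := mem_ball.1 hy
    have h1 : ‖x‖ ≤ ‖y‖ + dist y x := by
      rw [dist_eq_norm]
      calc ‖x‖ ≤ ‖y‖ + ‖x - y‖ := norm_le_insert' x y
        _ = ‖y‖ + ‖y - x‖ := by rw [norm_sub_rev]
    simp only [mem_compl_iff, mem_closedBall_zero_iff, not_le]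
    linarith
  have hup : ∫⁻ y in ball x δ, ‖curl v y‖ₑ ^ 2 < c :=
    (lintegral_mono_set hsub).trans_lt (hR₀ R₀ le_rfl)
  exact absurd (hlow.trans_lt hup) (lt_irrefl _)

/-- **The vorticity maximum is ATTAINED** for a class field with `curl v ≢ 0`: decay at infinity
(`exists_norm_curl_lt`) + compactness of closed balls. This is the fact behind p.8 l.47–53 «the spatial point
x*_t where the vorticity magnitude attains its global maximum». [cite: Zhong2026, proof of Theorem 6.2 p.8 l.47–53] -/
theorem exists_forall_norm_curl_le {v : E3 → E3} (hv : ContDiff ℝ ∞ v)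
    (hS : ∀ n : ℕ, ∫⁻ x, ‖iteratedFDeriv ℝ n v x‖ₑ ^ 2 < ⊤) {x₁ : E3} (hx₁ : curl v x₁ ≠ 0) :
    ∃ xs : E3, ∀ x, ‖curl v x‖ ≤ ‖curl v xs‖ := by
  obtain ⟨R, hR⟩ := exists_norm_curl_lt hv hS (norm_pos_iff.2 hx₁)
  set R' : ℝ := max R ‖x₁‖
  have hcont : Continuous fun x => ‖curl v x‖ :=
    (contDiff_curl (n := 2) (hv.of_le (by norm_cast))).continuous.norm
  obtain ⟨xs, -, hmax⟩ := (isCompact_closedBall (0 : E3) R').exists_isMaxOn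
    ⟨x₁, mem_closedBall_zero_iff.2 (le_max_right _ _)⟩ hcont.continuousOn
  refine ⟨xs, fun x => ?_⟩
  by_cases hx : ‖x‖ ≤ R'
  · exact isMaxOn_iff.1 hmax x (mem_closedBall_zero_iff.2 hx)
  · rw [not_le] at hx
    exact (hR x ((le_max_left _ _).trans_lt hx)).le.trans
      (isMaxOn_iff.1 hmax x₁ (mem_closedBall_zero_iff.2 (le_max_right _ _)))

/-- Slices `u t`, `t ∈ [0,T)`, of a class solution are smooth with all `L²` Sobolev seminorms finite
(`IsLocalSolution.sobolev` on `[0,t]`). [folklore] -/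
private theorem slice_regular {ν T : ℝ} {v₀ : E3 → E3} {u : ℝ → E3 → E3} {p : ℝ → E3 → ℝ}
    (h : IsLocalSolution ν T v₀ u p) {t : ℝ} (ht : t ∈ Ico 0 T) :
    ContDiff ℝ ∞ (u t) ∧ ∀ n : ℕ, ∫⁻ x, ‖iteratedFDeriv ℝ n (u t) x‖ₑ ^ 2 < ⊤ := by
  refine ⟨h.isClassical.contDiff_velocity ht, fun n => ?_⟩
  obtain ⟨C, hC⟩ := h.sobolev t ht.2 n
  exact (hC t ⟨ht.1, le_rfl⟩).trans_lt ENNReal.coe_lt_top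

/-- **VACUITY RECORD (2-READ typist-1 g5 (V) 12:21:52Z; REF-1 REV-2 CAUTION 12:28:09Z), kernel form**: the
print's standing hypotheses «ω ≠ 0 everywhere» (p.4 l.17) and «∇ψ ≠ 0 everywhere» (p.4 l.65–66) are JOINTLY
UNSATISFIABLE for a smooth field with square-integrable derivatives of all orders: `|ω|` attains its maximum
(`exists_forall_norm_curl_le`) and there `∇ψ = 0` (`floc_at_vortMax`). [cite: Zhong2026, §3.1 p.4 l.17; §4.1 p.4 l.65–66] -/
theorem not_gradNonVanishing {v : E3 → E3} (hv : ContDiff ℝ ∞ v)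
    (hS : ∀ n : ℕ, ∫⁻ x, ‖iteratedFDeriv ℝ n v x‖ₑ ^ 2 < ⊤) (hnv : NonVanishing (curl v)) :
    ¬ GradNonVanishing (curl v) := by
  intro hg
  obtain ⟨xs, hmax⟩ := exists_forall_norm_curl_le hv hS (hnv 0)
  have hd : DifferentiableAt ℝ (curl v) xs :=
    ((contDiff_curl (n := 2) (hv.of_le (by norm_cast))).differentiable (by norm_num)).differentiableAt
  exact hg xs (floc_at_vortMax 0 hd (hnv xs) hmax).1

/-- The same on the class `Chae2007.IsDatum`. [cite: Zhong2026, §3.1 p.4 l.17; §4.1 p.4 l.65–66] -/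
theorem not_gradNonVanishing_of_isDatum {v : E3 → E3} (hv : IsDatum v) (hnv : NonVanishing (curl v)) :
    ¬ GradNonVanishing (curl v) :=
  not_gradNonVanishing hv.1 hv.2.2 hnv

/-- **The frame `AtPhiMax` of the verbatim §4 faces is EMPTY** (no class solution, interior time and point satisfy
it). [cite: Zhong2026, §4.1 p.4 l.65–75] -/
theorem atPhiMax_false {ν T : ℝ} {v₀ : E3 → E3} {u : ℝ → E3 → E3} {p : ℝ → E3 → ℝ} {t : ℝ} {x₀ : E3}
    (hA : AtPhiMax ν T v₀ u p t x₀) : False := by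
  obtain ⟨hsol, ht, hnv, hg, -, -⟩ := hA
  obtain ⟨hsm, hS⟩ := slice_regular hsol ⟨ht.1.le, ht.2⟩
  exact not_gradNonVanishing hsm hS hnv hg

/-! ### Vacuous discharges of the verbatim faces

Each `…_holds` below holds VACUOUSLY — the printed standing hypotheses p.4 l.17 + l.65–66 are jointly
unsatisfiable on the class (`not_gradNonVanishing`, `atPhiMax_false`); it records the 2-READ/REF vacuity of the
face AS TYPED, not the print's inference, and says nothing about the `_loc` faces (rev 3), which carry the
non-vacuous content. -/

/-- `Step_sign` (p.5 l.83–85) holds VACUOUSLY (frame `AtPhiMax` empty, `atPhiMax_false`) — records the vacuity of the face as typed, not the print's inference. [cite: Zhong2026, §4.3 p.5 l.83–85] -/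
theorem step_sign_holds : Step_sign :=
  fun _ _ _ _ _ _ _ _ hA => (atPhiMax_false hA).elim

/-- `Step_18` ((18) p.5 l.85–92) holds VACUOUSLY (frame `AtPhiMax` empty, `atPhiMax_false`) — records the vacuity of the face as typed, not the print's inference. [cite: Zhong2026, (18) p.5 l.85–92] -/
theorem step_18_holds : Step_18 :=
  fun _ _ _ _ _ _ _ _ hA => (atPhiMax_false hA).elim

/-- `Step_19` ((19) p.6 l.2–9) holds VACUOUSLY (frame `AtPhiMax` empty, `atPhiMax_false`) — records the vacuity of the face as typed, not the print's inference. [cite: Zhong2026, (19) p.6 l.2–9] -/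
theorem step_19_holds : Step_19 :=
  fun _ _ _ _ _ _ _ _ hA => (atPhiMax_false hA).elim

/-- `Step_20` ((20) p.6 l.63–77) holds VACUOUSLY (frame `AtPhiMax` empty, `atPhiMax_false`) — records the vacuity of the face as typed, not the print's inference. [cite: Zhong2026, (20) p.6 l.63–77] -/
theorem step_20_holds : Step_20 :=
  fun _ _ _ _ _ _ _ _ hA => (atPhiMax_false hA).elim

/-- `Step_21` ((21) p.6 l.83–87) holds VACUOUSLY (frame `AtPhiMax` empty, `atPhiMax_false`) — records the vacuity of the face as typed, not the print's inference. [cite: Zhong2026, (21) p.6 l.83–87] -/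
theorem step_21_holds : Step_21 :=
  fun _ _ _ _ _ _ _ _ hA => (atPhiMax_false hA).elim

/-- `Step_L41` (Lemma 4.1 (14)/(15) p.5) holds VACUOUSLY (hypotheses `NonVanishing` ∧ `GradNonVanishing` unsatisfiable on the class, `not_gradNonVanishing_of_isDatum`) — records the vacuity of the face as typed, not the print's inference. [cite: Zhong2026, Lemma 4.1 (14) p.5 l.2–23] -/
theorem step_L41_holds : Step_L41 :=
  fun _ hv hnv hg _ _ => (not_gradNonVanishing_of_isDatum hv hnv hg).elim

/-- `Step_L43` (Lemma 4.3 (16) p.5 l.60–71) holds VACUOUSLY (hypotheses `NonVanishing` ∧ `GradNonVanishing` unsatisfiable on the class, `not_gradNonVanishing_of_isDatum`) — records the vacuity of the face as typed, not the print's inference. [cite: Zhong2026, Lemma 4.3 (16) p.5 l.60–71] -/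
theorem step_L43_holds : Step_L43 :=
  fun _ hv hnv hg _ _ => (not_gradNonVanishing_of_isDatum hv hnv hg).elim

/-- `Step_Hperp` (p.6 l.23–45) holds VACUOUSLY (hypotheses `NonVanishing` ∧ `GradNonVanishing` unsatisfiable on the class, `not_gradNonVanishing_of_isDatum`) — records the vacuity of the face as typed, not the print's inference. [cite: Zhong2026, §4.3 p.6 l.23–45] -/
theorem step_Hperp_holds : Step_Hperp :=
  fun _ hv hnv hg _ _ => (not_gradNonVanishing_of_isDatum hv hnv hg).elim

/-- `Step_subst19` holds because its conclusion `Step_19` holds vacuously. [cite: Zhong2026, (19) p.6 l.2–9] -/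
theorem step_subst19_holds : Step_subst19 := fun _ _ => step_19_holds

/-- `Step_AppB` holds because its conclusion `Step_21` holds vacuously. [cite: Zhong2026, (21) p.6 l.83–87; Appendix B p.9–10] -/
theorem step_AppB_holds : Step_AppB := fun _ => step_21_holds

/-- `Step_Case1` (Case 1 p.8 l.42–44) holds VACUOUSLY given the standing hypothesis «ω ≠ 0 everywhere»: at the
ATTAINED vorticity maximum the local functional equals `‖ω‖_∞ > 0` (`floc_at_vortMax`), so no F-maximiser has
`f ≤ 0` — Case 1 never occurs on the class (2-READ C2: F(t) = ‖ω(t)‖_∞). Records the vacuity, not the print's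
inference from Lemma 3.1. [cite: Zhong2026, proof of Theorem 6.2, Case 1 p.8 l.42–44] -/
theorem step_Case1_holds : Step_Case1 := by
  intro _ ν hν T hT v₀ u p hsol hnv hex
  obtain ⟨t₁, ht₁, x₁, hF, hle⟩ := hex
  obtain ⟨hsm, hS⟩ := slice_regular hsol ht₁
  obtain ⟨xs, hmax⟩ := exists_forall_norm_curl_le hsm hS (hnv t₁ ht₁ 0)
  have hd : DifferentiableAt ℝ (curl (u t₁)) xs :=
    ((contDiff_curl (n := 2) (hsm.of_le (by norm_cast))).differentiable (by norm_num)).differentiableAt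
  have hfs : floc ν (curl (u t₁)) xs = ‖curl (u t₁) xs‖ := (floc_at_vortMax ν hd (hnv t₁ ht₁ xs) hmax).2
  have hpos : 0 < floc ν (curl (u t₁)) xs := by
    rw [hfs]; exact norm_pos_iff.2 (hnv t₁ ht₁ xs)
  exact absurd ((hF xs).trans hle) (not_le.2 hpos)

/-! ### The attained-sup frame of Φ is empty too (REF-1 REV-2 CAUTION 12:28:09Z, kernel form)

For a class field with nowhere-vanishing vorticity, `Φ = e^ψ/|∇ψ|²` has NO global maximiser: the zero set of the
continuous field `∇ψ` is closed, nonempty (the vorticity maximiser) and not all of `ℝ³` (else `|ω|` is constant,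
against decay), so by connectedness it has a boundary point `z`; along points `x → z` with `∇ψ(x) ≠ 0` one has
`Φ(x) = |ω(x)|/|∇ψ(x)|² → ∞`. Hence the point-grain frame `AtPhiMaxPt` (rev 2) is empty as well and the `_pt`
faces hold vacuously; the LOCAL frame `AtPhiLocMax` (rev 3) is the satisfiable one. (The same facts were
obtained independently, as a records-grade file, by the second refuter: refuter-4 g5,
`claims/Zhong2026/2nd-refuter4g5/Vacuity.d7cea10582b65e14.lean`, ADJUDICATED #144 (iii); this rev files them.) -/

/-- For a nowhere-vanishing `C¹` field `w`, `ψ = log ‖w‖` is `C¹`. [folklore] -/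
private theorem contDiff_psi {w : E3 → E3} (hw : ContDiff ℝ 1 w) (hnv : NonVanishing w) : ContDiff ℝ 1 (psi w) :=
  (hw.norm ℝ hnv).log fun x => (norm_pos_iff.2 (hnv x)).ne'

/-- … hence `∇ψ` is continuous. [folklore] -/
private theorem continuous_gpsi {w : E3 → E3} (hw : ContDiff ℝ 1 w) (hnv : NonVanishing w) : Continuous (gpsi w) := by
  have h : gpsi w = fun x => (InnerProductSpace.toDual ℝ E3).symm (fderiv ℝ (psi w) x) := rfl
  rw [h]
  exact (InnerProductSpace.toDual ℝ E3).symm.continuous.comp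
    ((contDiff_psi hw hnv).continuous_fderiv one_ne_zero)

/-- **`Φ` has no global maximiser** on a smooth field with square-integrable derivatives of all orders and
nowhere-vanishing vorticity (see the section docstring). [cite: Zhong2026, §4.1 p.4 l.71–75 («suppose the supremum is attained at an interior point x₀»)] -/
theorem not_isPhiMaxAt {v : E3 → E3} (hv : ContDiff ℝ ∞ v)
    (hS : ∀ n : ℕ, ∫⁻ x, ‖iteratedFDeriv ℝ n v x‖ₑ ^ 2 < ⊤) (hnv : NonVanishing (curl v)) (x₀ : E3) :
    ¬ IsPhiMaxAt (curl v) x₀ := by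
  intro hmaxΦ
  have hw1 : ContDiff ℝ 1 (curl v) := contDiff_curl (n := 1) (hv.of_le (by norm_cast))
  have hwc : Continuous (curl v) := hw1.continuous
  have hgc : Continuous (gpsi (curl v)) := continuous_gpsi hw1 hnv
  set Z : Set E3 := {x | gpsi (curl v) x = 0} with hZ
  have hZcl : IsClosed Z := isClosed_singleton.preimage hgc
  -- `Z` is nonempty: the vorticity maximiser
  obtain ⟨xs, hxs⟩ := exists_forall_norm_curl_le hv hS (hnv 0)
  have hZne : Z.Nonempty :=
    ⟨xs, (floc_at_vortMax 0 (hw1.differentiable one_ne_zero).differentiableAt (hnv xs) hxs).1⟩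
  -- `Z ≠ univ`: otherwise `ψ`, hence `|ω|`, is constant, contradicting decay at infinity
  have hZuniv : Z ≠ univ := by
    intro hZu
    have hfd : ∀ x, fderiv ℝ (psi (curl v)) x = 0 := by
      intro x
      have hx : gpsi (curl v) x = 0 := by
        have : x ∈ Z := hZu ▸ mem_univ x
        exact this
      have h2 : (InnerProductSpace.toDual ℝ E3).symm (fderiv ℝ (psi (curl v)) x) = 0 := hx
      simpa using h2
    have hconst : ∀ x y, psi (curl v) x = psi (curl v) y :=
      fun x y => is_const_of_fderiv_eq_zero ((contDiff_psi hw1 hnv).differentiable one_ne_zero) hfd x y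
    have hnorm : ∀ x y, ‖curl v x‖ = ‖curl v y‖ := by
      intro x y
      rw [← Real.exp_log (norm_pos_iff.2 (hnv x)), ← Real.exp_log (norm_pos_iff.2 (hnv y))]
      exact congrArg Real.exp (hconst x y)
    obtain ⟨R, hR⟩ := exists_norm_curl_lt hv hS (norm_pos_iff.2 (hnv 0))
    obtain ⟨e, hne⟩ := NormedSpace.exists_lt_norm ℝ E3 R
    have := hR e hne
    rw [hnorm e 0] at this
    exact lt_irrefl _ this
  -- by connectedness `Z` is not open: pick `z ∈ Z` in the closure of the complement
  have hZno : ¬ IsOpen Z := by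
    intro hZo
    rcases isClopen_iff.1 ⟨hZcl, hZo⟩ with h | h
    · exact hZne.ne_empty h
    · exact hZuniv h
  obtain ⟨z, hzZ, hzN⟩ : ∃ z ∈ Z, Z ∉ 𝓝 z := by
    by_contra h
    push Not at h
    exact hZno (isOpen_iff_mem_nhds.2 h)
  have hfreq : ∃ᶠ x in 𝓝 z, gpsi (curl v) x ≠ 0 := by
    rw [Filter.Frequently]
    intro hev
    exact hzN (hev.mono fun x hx => by simpa using hx)
  -- near `z`, `Φ` exceeds any bound, in particular `Φ(x₀)`
  set P : ℝ := Phi (curl v) x₀ with hP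
  set Q : ℝ := max P 0 + 1 with hQ
  have hQ0 : 0 < Q := by rw [hQ]; positivity
  have hPQ : P < Q := by rw [hQ]; linarith [le_max_left P 0]
  have hwz : 0 < ‖curl v z‖ := norm_pos_iff.2 (hnv z)
  have hgz : gpsi (curl v) z = 0 := hzZ
  have hev1 : ∀ᶠ x in 𝓝 z, ‖curl v z‖ / 2 < ‖curl v x‖ :=
    (hwc.norm.continuousAt (x := z)).eventually (lt_mem_nhds (by linarith))
  have hev2 : ∀ᶠ x in 𝓝 z, ‖gpsi (curl v) x‖ ^ 2 < ‖curl v z‖ / (2 * Q) := by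
    have hc : ContinuousAt (fun x => ‖gpsi (curl v) x‖ ^ 2) z := (hgc.norm.pow 2).continuousAt
    have h0 : (fun x => ‖gpsi (curl v) x‖ ^ 2) z < ‖curl v z‖ / (2 * Q) := by
      show ‖gpsi (curl v) z‖ ^ 2 < ‖curl v z‖ / (2 * Q)
      rw [hgz, norm_zero, zero_pow two_ne_zero]
      positivity
    exact hc.eventually (gt_mem_nhds h0)
  obtain ⟨x, hx0, hx1, hx2⟩ := (hfreq.and_eventually (hev1.and hev2)).exists
  have hΦx : Q < Phi (curl v) x := by
    have hb : 0 < ‖gpsi (curl v) x‖ ^ 2 := by positivity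
    unfold Phi
    rw [psi, Real.exp_log (norm_pos_iff.2 (hnv x)), lt_div_iff₀ hb]
    calc Q * ‖gpsi (curl v) x‖ ^ 2 < Q * (‖curl v z‖ / (2 * Q)) := by gcongr
      _ = ‖curl v z‖ / 2 := by field_simp
      _ < ‖curl v x‖ := hx1
  have := hmaxΦ x
  linarith

/-- **The frame `AtPhiMaxPt` (rev 2) is EMPTY.** [cite: Zhong2026, §4.1 p.4 l.65–75] -/
theorem atPhiMaxPt_false {ν T : ℝ} {v₀ : E3 → E3} {u : ℝ → E3 → E3} {p : ℝ → E3 → ℝ} {t : ℝ} {x₀ : E3}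
    (hA : AtPhiMaxPt ν T v₀ u p t x₀) : False := by
  obtain ⟨hsol, ht, hnv, hmax, -⟩ := hA
  obtain ⟨hsm, hS⟩ := slice_regular hsol ⟨ht.1.le, ht.2⟩
  exact not_isPhiMaxAt hsm hS hnv x₀ hmax

/-- `Step_sign_pt` holds VACUOUSLY (frame `AtPhiMaxPt` empty, `atPhiMaxPt_false`) — records the vacuity of the face as typed, not the print's inference. [cite: Zhong2026, §4.3 p.5 l.83–85] -/
theorem step_sign_pt_holds : Step_sign_pt :=
  fun _ _ _ _ _ _ _ _ hA => (atPhiMaxPt_false hA).elim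

/-- `Step_18_pt` holds VACUOUSLY (frame `AtPhiMaxPt` empty, `atPhiMaxPt_false`) — records the vacuity of the face as typed, not the print's inference. [cite: Zhong2026, (18) p.5 l.85–92] -/
theorem step_18_pt_holds : Step_18_pt :=
  fun _ _ _ _ _ _ _ _ hA => (atPhiMaxPt_false hA).elim

/-- `Step_19_pt` holds VACUOUSLY (frame `AtPhiMaxPt` empty, `atPhiMaxPt_false`) — records the vacuity of the face as typed, not the print's inference. [cite: Zhong2026, (19) p.6 l.2–9] -/
theorem step_19_pt_holds : Step_19_pt :=
  fun _ _ _ _ _ _ _ _ hA => (atPhiMaxPt_false hA).elim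

/-- `Step_20_pt` holds VACUOUSLY (frame `AtPhiMaxPt` empty, `atPhiMaxPt_false`) — records the vacuity of the face as typed, not the print's inference. [cite: Zhong2026, (20) p.6 l.63–77] -/
theorem step_20_pt_holds : Step_20_pt :=
  fun _ _ _ _ _ _ _ _ hA => (atPhiMaxPt_false hA).elim

/-- `Step_21_pt` holds VACUOUSLY (frame `AtPhiMaxPt` empty, `atPhiMaxPt_false`) — records the vacuity of the face as typed, not the print's inference. [cite: Zhong2026, (21) p.6 l.83–87] -/
theorem step_21_pt_holds : Step_21_pt :=
  fun _ _ _ _ _ _ _ _ hA => (atPhiMaxPt_false hA).elim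

/-- `Step_L43_pt` holds VACUOUSLY (`IsPhiMaxAt` unsatisfiable on the class with nowhere-vanishing vorticity, `not_isPhiMaxAt`). [cite: Zhong2026, Lemma 4.3 (16) p.5 l.60–71] -/
theorem step_L43_pt_holds : Step_L43_pt :=
  fun _ hv hnv x₀ hmax _ => (not_isPhiMaxAt hv.1 hv.2.2 hnv x₀ hmax).elim

/-- `Step_Hperp_pt` holds VACUOUSLY (`IsPhiMaxAt` unsatisfiable on the class with nowhere-vanishing vorticity, `not_isPhiMaxAt`). [cite: Zhong2026, §4.3 p.6 l.23–45] -/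
theorem step_Hperp_pt_holds : Step_Hperp_pt :=
  fun _ hv hnv x₀ hmax _ => (not_isPhiMaxAt hv.1 hv.2.2 hnv x₀ hmax).elim

/-- `Step_subst19_pt` holds because `Step_19_pt` holds vacuously. [cite: Zhong2026, (19) p.6 l.2–9] -/
theorem step_subst19_pt_holds : Step_subst19_pt := fun _ _ => step_19_pt_holds

/-- `Step_AppB_pt` holds because `Step_21_pt` holds vacuously. [cite: Zhong2026, (21) p.6 l.83–87] -/
theorem step_AppB_pt_holds : Step_AppB_pt := fun _ => step_21_pt_holds


/-! ### The printed chain reduced to its non-vacuous binders -/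

/-- **The print-order composition with every vacuous binder discharged**: of the sixteen binders of
`claim_of_printed_steps`, the Φ-framed §4 faces (`Step_sign`, `Step_subst19`, `Step_L43`, `Step_Hperp`,
`Step_AppB`) and `Step_Case1` hold vacuously and `Step_Case2` is proved (`step_Case2_holds`), so Theorem 6.2
follows from the local theory, BKM, the identity (17), the two geometric-constraint printings, the inferences
«(21) ⇒ (27)» and «(27) ⇒ Lemma 6.1», Lemma 3.1 and the case split `Step_exhaustive` (the ADJUDICATED #144
token, refuted). [cite: Zhong2026, §§3–6 pp.4–8] -/
theorem claim_of_nonvacuous_steps (h1 : Chae2007.Step_1) (hB : Step_BKM) (h17 : Step_17)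
    (hgl : Step_geom_le) (hgg : Step_geom_ge) (h27 : Step_27_of) (h61 : Step_L61_of27) (h31 : Step_L31)
    (hex : Step_exhaustive) : ClaimedTheorem :=
  claim_of_printed_steps h1 hB step_sign_holds h17 step_subst19_holds step_L43_holds step_Hperp_holds hgl
    step_AppB_holds hgg h27 h61 h31 step_Case1_holds step_Case2_holds hex

/-- The same with the tree's discharged local theory fed in. [cite: Zhong2026, §§3–6 pp.4–8] -/
theorem claim_of_nonvacuous_steps' (hB : Step_BKM) (h17 : Step_17) (hgl : Step_geom_le) (hgg : Step_geom_ge)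
    (h27 : Step_27_of) (h61 : Step_L61_of27) (h31 : Step_L31) (hex : Step_exhaustive) : ClaimedTheorem :=
  claim_of_nonvacuous_steps Chae2007.step_1_holds hB h17 hgl hgg h27 h61 h31 hex

/-! ## REV 5 (additive; ns-claims-typist-1 g5, D-0026): Lemma 3.1 is TRUE on the class -/

/-- **Lemma 3.1 (p.4 l.42–55) HOLDS on the class, non-vacuously**: for a class field with nowhere-vanishing
vorticity the bound is the ATTAINED vorticity maximum (`exists_forall_norm_curl_le`, rev 4); the 𝓕-hypotheses
(`IsFMaxAt`, `f = 0`) are not used — «TRUE-type at this class (H^∞ fields have bounded curl)», as the face's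
docstring says. [cite: Zhong2026, Lemma 3.1 p.4 l.42–55] -/
theorem step_L31_holds : Step_L31 := by
  intro ν _ v hv hnv x₀ _ _
  obtain ⟨xs, hxs⟩ := exists_forall_norm_curl_le hv.1 hv.2.2 (hnv x₀)
  exact ⟨‖curl v xs‖, hxs⟩

/-- The printed chain reduced further: with Lemma 3.1 discharged, Theorem 6.2 follows from the local theory, BKM,
(17), the two geometric-constraint printings, «(21) ⇒ (27)», «(27) ⇒ Lemma 6.1» and the refuted case split
`Step_exhaustive`. [cite: Zhong2026, §§3–6 pp.4–8] -/
theorem claim_of_nonvacuous_steps₂ (hB : Step_BKM) (h17 : Step_17) (hgl : Step_geom_le) (hgg : Step_geom_ge)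
    (h27 : Step_27_of) (h61 : Step_L61_of27) (hex : Step_exhaustive) : ClaimedTheorem :=
  claim_of_nonvacuous_steps' hB h17 hgl hgg h27 h61 step_L31_holds hex


/-! ## REV 7 (additive; ns-claims-lit-3 g9, D-0026): BKM as used is TRUE on the class; the chain's open binders -/

/-- **`Step_BKM` (p.8 l.38–39) HOLDS on the class** — Literature-side twin of the summit-side
`…Theorems.Zhong2026Salvage.step_BKM_holds` (p531475), proved directly: along a `Chae2007.IsLocalSolution` on
`[0,T)` a uniform bound `‖ω(t,x)‖ ≤ B` on `[0,T) × ℝ³` gives `∫⁻_{(0,T)} sup_x ‖ω‖ₑ ≤ ofReal B · T < ∞`, and the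
tree's DISCHARGED Beale–Kato–Majda a priori bound `MajdaBertozzi2002_bkmAprioriH3_holds` (Majda–Bertozzi 2002,
proof of Thm. 3.6) then bounds `Σ_{n≤3} ∫‖Dⁿu(t)‖²` uniformly on `[0,T)`, i.e. `¬ BlowsUpAt T u`.
[cite: Zhong2026, proof of Theorem 6.2 p.8 l.38–39 (citing [8] Beale–Kato–Majda 1984)]
[cite: MajdaBertozzi2002, Thm. 3.6 p.115 and its proof pp.116–117] -/
theorem step_BKM_holds : Step_BKM := by
  intro ν hν T hT v₀ u p hsol hB hblow
  obtain ⟨B, hBle⟩ := hB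
  -- the constant majorant bounds the `ℝ≥0∞`-valued vorticity supremum on `(0,T)`
  have hle : ∀ t ∈ Ioo 0 T, (⨆ x, ‖curl (u t) x‖ₑ) ≤ ENNReal.ofReal B := fun t ht =>
    iSup_le fun x => by
      rw [← ofReal_norm]
      exact ENNReal.ofReal_le_ofReal (hBle t (Ioo_subset_Ico_self ht) x)
  -- hence the BKM integral `∫₀ᵀ ‖ω‖_∞` is finite
  have hfin : (∫⁻ t in Ioo 0 T, ⨆ x, ‖curl (u t) x‖ₑ) < ⊤ := by
    refine lt_of_le_of_lt (setLIntegral_mono measurable_const hle) ?_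
    rw [setLIntegral_const, Real.volume_Ioo]
    exact ENNReal.mul_lt_top ENNReal.ofReal_lt_top ENNReal.ofReal_lt_top
  -- the Beale–Kato–Majda a priori `H³` bound excludes blow-up at `T`
  obtain ⟨A, hA⟩ := MajdaBertozzi2002_bkmAprioriH3_holds hν.le hT hsol.isClassical hsol.sobolev hfin
  exact hblow ⟨A, hA⟩

/-- **The printed chain reduced to its open binders.** With `Step_BKM` and Lemma 3.1 discharged and every
Φ-framed §4 face vacuous, the identity (17) (`Step_17`, flagged in its docstring, rev 6) and the «≤» printing
of the geometric constraint (`Step_geom_le`) are OFF-PATH: in `claim_of_nonvacuous_steps₂` they only build the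
argument of the vacuous `step_AppB_holds = fun _ => step_21_holds`. Theorem 6.2 as typed thus follows from
exactly four printed steps: the «≥» geometric constraint p.8 l.15–21 (`Step_geom_ge`), the inference
«(21) ⇒ (27)» p.8 l.13–22 (`Step_27_of`), the Danskin-type passage «(27) ⇒ Lemma 6.1» p.8 l.31–35
(`Step_L61_of27`) and the case split p.8 l.40–84 (`Step_exhaustive`, the ADJUDICATED #144 token, refuted).
[cite: Zhong2026, §§3–6 pp.4–8] -/
theorem claim_of_nonvacuous_steps₃ (hgg : Step_geom_ge) (h27 : Step_27_of) (h61 : Step_L61_of27)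
    (hex : Step_exhaustive) : ClaimedTheorem :=
  claim_of_steps Chae2007.step_1_holds step_BKM_holds
    (vortBound_of_cases step_L31_holds (h61 (h27 step_21_holds hgg)) step_Fge_holds step_Case1_holds
      step_Case2_holds hex)

/-- Clay (A) from the four open binders. [cite: Zhong2026, Theorem 6.2 p.8] -/
theorem clay_of_nonvacuous_steps₃ (hgg : Step_geom_ge) (h27 : Step_27_of) (h61 : Step_L61_of27)
    (hex : Step_exhaustive) : ClayVariants.clayR3.Regularity :=
  clay_of_claimed (claim_of_nonvacuous_steps₃ hgg h27 h61 hex)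


/-! ## REV 8 (additive; ns-claims-lit-3 g9, records): the CORRECT (17) in-file — Literature-side twin of
## `…Theorems.Zhong2026Salvage.matDpsi_eq` / `printed17_iff_gpsi_eq_zero` / `step_17_iff_frame_empty` (p537261)

Ported BY NAME from the summit-side records file `Theorems/SoloSalvageZhong2026LogVorticity.lean` (salvage-p1,
p537261; proofs copied, tree tools `VorticityDirectionDynamics.NavierStokes.hasDerivAt_norm_curl`,
`IsClassicalNSSolutionOn.vorticity_eq`, `IsSmoothSpaceTimeOn.hasDerivWithinAt_curl_slice`), so that the flagged
face `Step_17` (rev 6 docstring) carries its kernel characterisation in its own file; listed «OPEN FOR A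
SUCCESSOR» by ns-claims-typist-1 g5 (15:35:21Z). Nothing here touches the head `Step_exhaustive` (#144). -/

section Rev8

variable {ν T : ℝ} {v₀ : E3 → E3} {u : ℝ → E3 → E3} {p : ℝ → E3 → ℝ} {t : ℝ}

/-- Slices of a class solution are smooth (class `X`, p.1–2). [folklore] -/
private theorem slice_contDiff (hsol : IsLocalSolution ν T v₀ u p) (ht : t ∈ Ico 0 T) : ContDiff ℝ ∞ (u t) :=
  hsol.isClassical.contDiff_velocity ht

/-- Slices of a class solution have all `L²` Sobolev seminorms finite (`IsLocalSolution.sobolev` on `[0,t]`).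
[folklore] -/
private theorem slice_sobolev (hsol : IsLocalSolution ν T v₀ u p) (ht : t ∈ Ico 0 T) (n : ℕ) :
    ∫⁻ x, ‖iteratedFDeriv ℝ n (u t) x‖ₑ ^ 2 < ⊤ := by
  obtain ⟨C, hC⟩ := hsol.sobolev t ht.2 n
  exact (hC t ⟨ht.1, le_rfl⟩).trans_lt ENNReal.coe_lt_top

/-- **The pointwise vorticity equation (2) p.1 at interior times**, as a two-sided time derivative:
`∂ₜω = νΔω − (u·∇)ω + (ω·∇)u` at `(t,x)`, `t ∈ (0,T)` (the tree's `IsClassicalNSSolutionOn.vorticity_eq` on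
`[0,T)` plus `∂ₜ curl = curl ∂ₜ`, `IsSmoothSpaceTimeOn.hasDerivWithinAt_curl_slice`). Twin of
`…Zhong2026Salvage.hasDerivAt_curl`. [cite: Zhong2026, (2) p.1 l.31–35 (vorticity equation)] -/
theorem hasDerivAt_curl_interior (hsol : IsLocalSolution ν T v₀ u p) (ht : t ∈ Ioo 0 T) (x : E3) :
    HasDerivAt (fun s => curl (u s) x)
      (ν • (Δ (curl (u t))) x - convect (u t) (curl (u t)) x + convect (curl (u t)) (u t) x) t := by
  have hT : (0 : ℝ) < T := ht.1.trans ht.2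
  have hS : UniqueDiffOn ℝ (Ico (0 : ℝ) T) := uniqueDiffOn_Ico 0 T
  have hcl : Ico (0 : ℝ) T ⊆ closure (interior (Ico (0 : ℝ) T)) := by
    rw [interior_Ico, closure_Ioo hT.ne]
    exact Ico_subset_Icc_self
  have htS : t ∈ Ico (0 : ℝ) T := ⟨ht.1.le, ht.2⟩
  have hcurl : ∀ s ∈ Ico (0 : ℝ) T, ∀ y : E3, curl ((0 : ℝ → E3 → E3) s) y = 0 :=
    fun s _ y => curl_zero y
  have heq := hsol.isClassical.vorticity_eq hS hcl hcurl htS x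
  have hd : HasDerivWithinAt (fun s => curl (u s) x) (curl (timeDerivWithin (Ico 0 T) u t) x)
      (Ico 0 T) t :=
    hsol.isClassical.smooth_velocity.hasDerivWithinAt_curl_slice hS hcl htS x
  have h1 : timeDerivWithin (Ico 0 T) (vorticity u) t x = curl (timeDerivWithin (Ico 0 T) u t) x := by
    have h2 : HasDerivWithinAt (fun s => vorticity u s x) (curl (timeDerivWithin (Ico 0 T) u t) x)
        (Ico 0 T) t := by
      simpa only [vorticity_apply] using hd
    exact h2.derivWithin (hS t htS)
  rw [h1, vorticity_apply] at heq
  have hval : curl (timeDerivWithin (Ico 0 T) u t) x =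
      ν • (Δ (curl (u t))) x - convect (u t) (curl (u t)) x + convect (curl (u t)) (u t) x := by
    calc curl (timeDerivWithin (Ico 0 T) u t) x
        = (curl (timeDerivWithin (Ico 0 T) u t) x + convect (u t) (curl (u t)) x) -
            convect (u t) (curl (u t)) x := by abel
      _ = (convect (curl (u t)) (u t) x + ν • (Δ (curl (u t))) x) - convect (u t) (curl (u t)) x := by
            rw [heq]
      _ = _ := by abel
  exact (hd.hasDerivAt (Ico_mem_nhds ht.1 ht.2)).congr_deriv hval

/-- `⟪v, ∇ψ(x)⟫ = D|ω|(x)(v)/|ω(x)|` for `ψ = ln|ω|`, `ω(x) ≠ 0` (chain rule; `gpsi` is Mathlib's gradient).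
Twin of `…Zhong2026Salvage.inner_gpsi_eq`. [cite: Zhong2026, (10)–(11) p.4 l.17–33] -/
theorem inner_gpsi_eq {w : E3 → E3} (hw : ContDiff ℝ 1 w) {x : E3} (hx : w x ≠ 0) (v : E3) :
    ⟪v, gpsi w x⟫ = ‖w x‖⁻¹ * fderiv ℝ (fun y => ‖w y‖) x v := by
  have hdn : DifferentiableAt ℝ (fun y => ‖w y‖) x :=
    ((hw.differentiable one_ne_zero).differentiableAt).norm ℝ hx
  have hfd : fderiv ℝ (psi w) x = (‖w x‖)⁻¹ • fderiv ℝ (fun y => ‖w y‖) x := by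
    show fderiv ℝ (fun y => Real.log ‖w y‖) x = _
    exact fderiv.log hdn (norm_ne_zero_iff.2 hx)
  unfold gpsi
  rw [real_inner_comm, gradient, InnerProductSpace.toDual_symm_apply, hfd]
  rfl

/-- The stretching rate `α = ⟪ξ, ∇u ξ⟫` of the tree (`vorticityDirection`) equals the print's `S₀ = ω̂·∇v·ω̂`
(4) p.3. Twin of `…Zhong2026Salvage.alpha_eq_S0`. [cite: Zhong2026, (4) p.3 l.14–17] -/
theorem alpha_eq_S0 (v : E3 → E3) {x : E3} (hx : curl v x ≠ 0) :
    ⟪vorticityDirection (curl v) x, fderiv ℝ v x (vorticityDirection (curl v) x)⟫ = S0 v x := by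
  unfold S0
  rw [vorticityDirection_apply, map_smul, real_inner_smul_left, real_inner_smul_right]
  have hρ : ‖curl v x‖ ≠ 0 := norm_ne_zero_iff.2 hx
  field_simp

/-- **The CORRECT display (17)** (Constantin 1994; Galanti–Gibbon–Heritage 1997 §3 (Dw1)+(Dw4); the print's (17)
p.5 l.72–82 WITHOUT its spurious term `−ν|∇ψ|²`): along a class solution on `[0,T)`, at `t ∈ (0,T)` and a point
with `ω(t,x) ≠ 0`, `Dψ/Dt = S₀ + ν Δe^ψ/e^ψ − ν|∇ω̂|²` in the skeleton's vocabulary (`matDpsi`, `S0`, `lapRatio`,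
`gradDirSq`; `dirField = vorticityDirection` definitionally). Any `ν : ℝ`. Twin of
`…Zhong2026Salvage.matDpsi_eq` (p537261). [cite: Zhong2026, (17) p.5 l.72–82]
[cite: GalantiGibbonHeritage1997, §3 (Dw1), (Dw4)] -/
theorem matDpsi_eq (hsol : IsLocalSolution ν T v₀ u p) (ht : t ∈ Ioo 0 T) {x : E3}
    (hx : curl (u t) x ≠ 0) :
    matDpsi u t x = S0 (u t) x + ν * lapRatio (curl (u t)) x - ν * gradDirSq (curl (u t)) x := by
  have htS : t ∈ Ico (0 : ℝ) T := ⟨ht.1.le, ht.2⟩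
  have hsm : ContDiff ℝ ∞ (u t) := slice_contDiff hsol htS
  have hω2 : ContDiff ℝ 2 (curl (u t)) := contDiff_curl (n := 2) (hsm.of_le (by norm_cast))
  have hω1 : ContDiff ℝ 1 (curl (u t)) := contDiff_curl (n := 1) (hsm.of_le (by norm_cast))
  have hρ : ‖curl (u t) x‖ ≠ 0 := norm_ne_zero_iff.2 hx
  -- magnitude equation (GGH97 (Dw1)+(Dw4)) at `(t,x)`
  have hD := VorticityDirectionDynamics.NavierStokes.hasDerivAt_norm_curl hω2.contDiffAt hx
    (hasDerivAt_curl_interior hsol ht x)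
  -- `∂ₜψ`
  have hψ : HasDerivAt (fun s => psi (curl (u s)) x) (_ / ‖curl (u t) x‖) t := hD.log hρ
  unfold matDpsi
  rw [hψ.deriv, inner_gpsi_eq hω1 hx, alpha_eq_S0 (u t) hx]
  unfold lapRatio gradDirSq
  rw [show dirField (curl (u t)) = vorticityDirection (curl (u t)) from rfl]
  field_simp
  ring

/-- **The printed (17) at a point ⇔ `∇ψ = 0` there** (`ν ≠ 0`): the display carries the spurious `−ν|∇ψ|²`.
Twin of `…Zhong2026Salvage.printed17_iff_gpsi_eq_zero`. [cite: Zhong2026, (17) p.5 l.72–82] -/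
theorem printed17_iff_gpsi_eq_zero (hsol : IsLocalSolution ν T v₀ u p) (hν : ν ≠ 0) (ht : t ∈ Ioo 0 T)
    {x : E3} (hx : curl (u t) x ≠ 0) :
    matDpsi u t x = S0 (u t) x + ν * lapRatio (curl (u t)) x - ν * ‖gpsi (curl (u t)) x‖ ^ 2 -
        ν * gradDirSq (curl (u t)) x ↔ gpsi (curl (u t)) x = 0 := by
  rw [matDpsi_eq hsol ht hx]
  constructor
  · intro h
    have h2 : ν * ‖gpsi (curl (u t)) x‖ ^ 2 = 0 := by linarith
    rcases mul_eq_zero.1 h2 with h3 | h3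
    · exact absurd h3 hν
    · exact norm_eq_zero.1 ((pow_eq_zero_iff two_ne_zero).1 h3)
  · intro h
    rw [h, norm_zero]
    ring

/-- If `∇ψ ≡ 0` for a `C¹` nowhere-vanishing field then `|ω|` is constant (`ψ = ln|ω|` has zero derivative on the
connected space `ℝ³`) — the print's ψ of (10) p.4 under the conclusion the printed (17) forces. Twin of
`…Zhong2026Salvage.norm_eq_norm_of_gpsi_eq_zero`. [cite: Zhong2026, (10) p.4 l.17–18; (17) p.5 l.72–82] -/
theorem norm_eq_norm_of_gpsi_eq_zero {w : E3 → E3} (hw : ContDiff ℝ 1 w) (hnv : NonVanishing w)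
    (hg : ∀ x, gpsi w x = 0) (x y : E3) : ‖w x‖ = ‖w y‖ := by
  have hdiff : Differentiable ℝ (psi w) := fun z => by
    show DifferentiableAt ℝ (fun y => Real.log ‖w y‖) z
    exact (((hw.differentiable one_ne_zero).differentiableAt).norm ℝ (hnv z)).log
      (norm_ne_zero_iff.2 (hnv z))
  have hfd : ∀ z, fderiv ℝ (psi w) z = 0 := fun z => by
    have h := hg z
    unfold gpsi gradient at h
    simpa using h
  have hc : psi w x = psi w y := is_const_of_fderiv_eq_zero hdiff hfd x y
  exact Real.log_injOn_pos (mem_Ioi.2 (norm_pos_iff.2 (hnv x))) (mem_Ioi.2 (norm_pos_iff.2 (hnv y))) hc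

/-- **`Step_17` ⇔ its own frame is empty.** The printed (17), asserted at every point of every interior
vorticity slice that vanishes nowhere, holds IFF no class solution (`ν > 0`) has such a slice: on a slice with
`ω ≠ 0` everywhere the printed display forces `∇ψ ≡ 0` (`printed17_iff_gpsi_eq_zero`), so `|ω|` is a positive
constant (`norm_eq_norm_of_gpsi_eq_zero`), contradicting the decay of `H^∞` slices (`exists_norm_curl_lt`,
rev 4); conversely an empty frame makes `Step_17` vacuous. Whether the frame is empty is NOT decided here. Twin
of `…Zhong2026Salvage.step_17_iff_frame_empty` (p537261). [cite: Zhong2026, (17) p.5 l.72–82; §3.1 p.4 l.17] -/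
theorem step_17_iff_frame_empty : Step_17 ↔
    ∀ ν : ℝ, 0 < ν → ∀ (T : ℝ) (v₀ : E3 → E3) (u : ℝ → E3 → E3) (p : ℝ → E3 → ℝ),
      IsLocalSolution ν T v₀ u p → ∀ t ∈ Ioo 0 T, ¬ NonVanishing (curl (u t)) := by
  constructor
  · intro h17 ν hν T v₀ u p hsol t ht hnv
    have htS : t ∈ Ico (0 : ℝ) T := ⟨ht.1.le, ht.2⟩
    have hsm : ContDiff ℝ ∞ (u t) := slice_contDiff hsol htS
    have hg : ∀ x, gpsi (curl (u t)) x = 0 := fun x =>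
      (printed17_iff_gpsi_eq_zero hsol hν.ne' ht (hnv x)).1 (h17 ν hν T v₀ u p hsol t ht hnv x)
    have hw1 : ContDiff ℝ 1 (curl (u t)) := contDiff_curl (n := 1) (hsm.of_le (by norm_cast))
    have hconst := norm_eq_norm_of_gpsi_eq_zero hw1 hnv hg
    obtain ⟨R, hR⟩ := exists_norm_curl_lt hsm (slice_sobolev hsol htS) (norm_pos_iff.2 (hnv 0))
    have hz : 0 < ‖curl (u t) 0‖ := norm_pos_iff.2 (hnv 0)
    set y : E3 := ((|R| + 1) / ‖curl (u t) 0‖) • curl (u t) 0 with hy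
    have hyn : R < ‖y‖ := by
      rw [hy, norm_smul, Real.norm_eq_abs, abs_of_pos (by positivity), div_mul_cancel₀ _ hz.ne']
      linarith [le_abs_self R]
    have hlt := hR y hyn
    rw [hconst y 0] at hlt
    exact lt_irrefl _ hlt
  · intro h ν hν T v₀ u p hsol t ht hnv x
    exact absurd hnv (h ν hν T v₀ u p hsol t ht)



/-! ### The pointwise grain `Step_17_loc` (rev 3) characterised: it says every interior slice is irrotational -/

/-- **A smooth `H^∞` field whose log-vorticity has zero gradient wherever `ω ≠ 0` is irrotational.** On the
open set `U = {ω ≠ 0}` the function `ψ = ln|ω|` has zero derivative, so each level set `{|ω| = c}`, `c > 0`, is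
open (`IsOpen.isOpen_inter_preimage_of_fderiv_eq_zero`) and closed, hence all of `ℝ³` once nonempty — against
the decay `exists_norm_curl_lt` (rev 4). This is the field-level content of the printed (17) at the pointwise
grain (`step_17_loc_iff_irrotational`). [cite: Zhong2026, (10) p.4 l.17–18; (17) p.5 l.72–82; §3.1 p.4 l.17] -/
theorem curl_eq_zero_of_gpsi_eq_zero {v : E3 → E3} (hv : ContDiff ℝ ∞ v)
    (hS : ∀ n : ℕ, ∫⁻ x, ‖iteratedFDeriv ℝ n v x‖ₑ ^ 2 < ⊤)
    (hg : ∀ x, curl v x ≠ 0 → gpsi (curl v) x = 0) (x : E3) : curl v x = 0 := by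
  by_contra hx
  set w : E3 → E3 := curl v with hw_def
  have hw1 : ContDiff ℝ 1 w := contDiff_curl (n := 1) (hv.of_le (by norm_cast))
  have hwc : Continuous w := hw1.continuous
  set c : ℝ := ‖w x‖ with hc_def
  have hc : 0 < c := norm_pos_iff.2 hx
  -- `U = {w ≠ 0}` is open and `ψ` has zero derivative on it
  have hU : IsOpen {y : E3 | w y ≠ 0} := isOpen_ne_fun hwc continuous_const
  have hdiff : DifferentiableOn ℝ (psi w) {y : E3 | w y ≠ 0} := fun y hy =>
    ((((hw1.differentiable one_ne_zero).differentiableAt).norm ℝ hy).log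
      (norm_ne_zero_iff.2 hy)).differentiableWithinAt
  have hfd : {y : E3 | w y ≠ 0}.EqOn (fderiv ℝ (psi w)) 0 := fun y hy => by
    have h := hg y hy
    unfold gpsi gradient at h
    simpa using h
  -- the level set `{|w| = c}` is clopen and nonempty, hence everything
  have hV : {y : E3 | w y ≠ 0} ∩ psi w ⁻¹' {psi w x} = {y : E3 | ‖w y‖ = c} := by
    ext y
    simp only [mem_inter_iff, mem_setOf_eq, mem_preimage, mem_singleton_iff]
    constructor
    · rintro ⟨hy, hψ⟩
      exact Real.log_injOn_pos (mem_Ioi.2 (norm_pos_iff.2 hy)) (mem_Ioi.2 hc) hψ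
    · intro hy
      have hy' : w y ≠ 0 := norm_pos_iff.1 (hy ▸ hc)
      exact ⟨hy', by unfold psi; rw [hy]⟩
  have hopen : IsOpen {y : E3 | ‖w y‖ = c} := by
    rw [← hV]
    exact hU.isOpen_inter_preimage_of_fderiv_eq_zero hdiff hfd {psi w x}
  have hclosed : IsClosed {y : E3 | ‖w y‖ = c} := isClosed_eq (continuous_norm.comp hwc) continuous_const
  have huniv : {y : E3 | ‖w y‖ = c} = univ := IsClopen.eq_univ ⟨hclosed, hopen⟩ ⟨x, rfl⟩
  have hall : ∀ y : E3, ‖w y‖ = c := fun y => by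
    have : y ∈ {y : E3 | ‖w y‖ = c} := huniv ▸ mem_univ y
    exact this
  -- against decay at infinity
  obtain ⟨R, hR⟩ := exists_norm_curl_lt hv hS hc
  have hz : 0 < ‖w 0‖ := by rw [hall 0]; exact hc
  set y : E3 := ((|R| + 1) / ‖w 0‖) • w 0 with hy
  have hyn : R < ‖y‖ := by
    rw [hy, norm_smul, Real.norm_eq_abs, abs_of_pos (by positivity), div_mul_cancel₀ _ hz.ne']
    linarith [le_abs_self R]
  have hlt := hR y hyn
  rw [← hw_def, hall y] at hlt
  exact lt_irrefl _ hlt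

/-- **`Step_17_loc` ⇔ every interior slice of every class solution is irrotational.** At the pointwise grain
(rev 3: the printed (17) asserted at every point where `ω(t,x) ≠ 0`), the spurious `−ν|∇ψ|²` forces `∇ψ = 0`
wherever `ω ≠ 0` (`printed17_iff_gpsi_eq_zero`), hence `ω(t,·) ≡ 0` (`curl_eq_zero_of_gpsi_eq_zero`);
conversely irrotational slices make the face vacuous. A kernel witness of ONE class solution with a
non-irrotational interior slice (local theory `Chae2007.step_1_holds` from a datum with `curl v₀ ≢ 0`, plus
continuity at `t = 0⁺`) would therefore decide `Step_17_loc` (and is refuter material, not built here).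
[cite: Zhong2026, (17) p.5 l.72–82] -/
theorem step_17_loc_iff_irrotational : Step_17_loc ↔
    ∀ ν : ℝ, 0 < ν → ∀ (T : ℝ) (v₀ : E3 → E3) (u : ℝ → E3 → E3) (p : ℝ → E3 → ℝ),
      IsLocalSolution ν T v₀ u p → ∀ t ∈ Ioo 0 T, ∀ x, curl (u t) x = 0 := by
  constructor
  · intro h ν hν T v₀ u p hsol t ht
    have htS : t ∈ Ico (0 : ℝ) T := ⟨ht.1.le, ht.2⟩
    exact curl_eq_zero_of_gpsi_eq_zero (slice_contDiff hsol htS) (slice_sobolev hsol htS)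
      fun x hx => (printed17_iff_gpsi_eq_zero hsol hν.ne' ht hx).1 (h ν hν T v₀ u p hsol t ht x hx)
  · intro h ν hν T v₀ u p hsol t ht x hx
    exact absurd (h ν hν T v₀ u p hsol t ht x) hx

/-- Hence `Step_17_loc` empties the frame of `Step_17` (consistent with `step17_of_loc`, rev 3).
[cite: Zhong2026, (17) p.5 l.72–82] -/
theorem frame_empty_of_step_17_loc (h : Step_17_loc) :
    ∀ ν : ℝ, 0 < ν → ∀ (T : ℝ) (v₀ : E3 → E3) (u : ℝ → E3 → E3) (p : ℝ → E3 → ℝ),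
      IsLocalSolution ν T v₀ u p → ∀ t ∈ Ioo 0 T, ¬ NonVanishing (curl (u t)) :=
  fun ν hν T v₀ u p hsol t ht hnv => hnv 0 (step_17_loc_iff_irrotational.1 h ν hν T v₀ u p hsol t ht 0)

end Rev8

end

end Literature.Claims.NS.Zhong2026
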